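import Literature.Analysis.UnboundedOperators.HeatKernelGradient
import Literature.Analysis.UnboundedOperators.HeatKernelFourier
import Literature.Analysis.FunctionSpaces.PlancherelL1L2
import Literature.Analysis.SingularIntegrals.CalderonZygmundLp
import Literature.Analysis.Fourier.SobolevMultiplierBound
import Literature.Analysis.Fourier.MultiplierOpL2
import Literature.Analysis.Fourier.LpMultiplierDilation
import Mathlib.Analysis.Fourier.Convolution
import Mathlib.Analysis.Fourier.FourierTransformDeriv
import Mathlib.MeasureTheory.Function.LpSpace.Complete
import Mathlib.Analysis.SpecialFunctions.Gamma.Basic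
import Mathlib.Analysis.SpecialFunctions.Gaussian.GaussianIntegral
import Mathlib.MeasureTheory.Function.SpecialFunctions.Inner
import Mathlib.MeasureTheory.Integral.Prod
import HarnessLib

/-!
# The Riesz transforms are `Lᵖ` multipliers, `1 < p < ∞`: discharge of `rieszTransform_isLpMultiplier`

Analysis/Fourier proof file; sibling of `SobolevMultiplierBound` (the named fact
`Literature.Analysis.Fourier.rieszTransform_isLpMultiplier`: for all `d k`, `j : Fin d` and
`1 < p < ∞`, the matrix symbol `rⱼ(ξ) • 1 = (-iξⱼ/|ξ|) 1_{k×k}` is an `Lᵖ` Fourier multiplier on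
`ℂᵏ`-valued Schwartz functions on `ℝᵈ` [Grafakos2014, Cor. 5.2.8 and Prop. 5.1.14]). This file
PROVES it: `rieszTransform_isLpMultiplier_holds`.

## The argument (as formalised)

Grafakos proves Cor. 5.2.8 by the method of rotations (Thm. 5.2.7, directional Hilbert
transforms) and identifies kernel and symbol in Prop. 5.1.14 (polar coordinates, `∫ sin t/t`,
Lemma 5.1.15); none of these tools is in Mathlib. We use instead the Calderón–Zygmund theorem
for convolution operators with bounded kernels — an `L²` bound plus Hörmander's condition give a
uniform `Lᵖ` bound, `1 < p < ∞` [Grafakos2014, Thm. 5.3.3; Stein1971, Ch. II §2.2 Thm 1 and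
§3.2 Thm 2] — which the tree has PROVED (`Literature.Analysis.SingularIntegrals.exists_eLpNorm_le`),
applied to truncations of the Riesz kernel subordinated to the heat kernel
`K_t(x) = (4πt)^{-n/2}e^{-|x|²/4t}` (`Literature.Analysis.UnboundedOperators.heatKernel`) through
the Γ-function identity `|ξ|^{-1} = π^{-1/2} ∫_0^∞ t^{-1/2} e^{-t|ξ|²} dt`
[Stein1971, Ch. III §2.1 (β) and §3.4]:

1. `rieszKernelTrunc v ε R x = -π^{-1/2} ∫_{[ε,R]} t^{-1/2} ∂ᵥK_t(x) dt` (`0 < ε ≤ R`, direction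
   `v`) is bounded, measurable and integrable (`integrable_rieszIntegrand_prod`: the integrand is
   dominated by a Gaussian on `[ε,R] × E`).
2. Its Fourier transform (Fubini; `𝓕(∂ᵥK_t)(ξ) = 2πi⟨ξ,v⟩e^{-4π²t|ξ|²}`) is
   `rieszSymbolTrunc v ε R ξ = -2√π i ⟨ξ,v⟩ ∫_{[ε,R]} t^{-1/2}e^{-4π²t|ξ|²} dt`
   (`fourier_ofReal_rieszKernelTrunc`). The `t`-integrand being positive,
   `|rieszSymbolTrunc v ε R ξ| ≤ |⟨ξ,v⟩|/|ξ| ≤ ‖v‖` uniformly (`norm_rieszSymbolTrunc_le`), and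
   `rieszSymbolTrunc v (1/(n+1)) (n+1) ξ → -i⟨ξ,v⟩/|ξ| = rieszSymbolDir v ξ` for `ξ ≠ 0`
   (`tendsto_rieszSymbolTrunc`; `∫_0^∞ t^{-1/2}e^{-at} dt = Γ(1/2) a^{-1/2}`).
3. `L²` bound with constant `1` on `C_c` inputs (`eLpNorm_two_conv_rieszKernelTrunc_le`):
   the convolution theorem (Mathlib) and Plancherel on `L¹ ∩ L²` (tree, `PlancherelL1L2`).
4. Hörmander's condition uniformly in `ε, R` (`lintegral_rieszKernelTrunc_sub_le`): the Hessian
   bound `‖D(∂ᵥK_t)(z)‖ ≤ (4πt)^{-n/2} t⁻¹ e^{-|z|²/8t} ‖v‖`, the mean value inequality on the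
   segment `[x-y, x]` (where `|z| ≥ |x|/2` when `2|y| ≤ |x|`) and the time integral
   `∫_0^∞ t^{-α-1}e^{-c/t} dt = c^{-α}Γ(α)` give the standard estimate
   `|k(x-y) - k(x)| ≤ A_n ‖v‖ |y| |x|^{-n-1}` (`abs_rieszKernelTrunc_sub_le`); integrating over
   `|x| ≥ 2|y|` after the scaling `x = |y|u` gives a finite bound (`rieszHormanderBound`, through
   `∫ (1+|u|)^{-n-1} du < ∞`).
5. The CZ theorem then gives ONE constant for all truncations on the admissible class (bounded,
   compactly supported, measurable, real inputs); it passes to complex Schwartz inputs by cut-off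
   on balls, dominated convergence, Fatou, and real/imaginary parts (`eLpNorm_conv_schwartz_le`).
6. For Schwartz `f`, `𝓕⁻¹(rieszSymbolTrunc · 𝓕f)` IS the truncated convolution (convolution
   theorem and Fourier inversion, `fourierInv_rieszSymbolTrunc_mul_eq`); along `ε = 1/(n+1)`,
   `R = n+1`, dominated convergence on the Fourier side and Fatou give
   `‖𝓕⁻¹(rieszSymbolDir v · 𝓕f)‖_p ≤ C ‖f‖_p` (`exists_eLpNorm_fourierInv_rieszSymbolDir_le`).
7. On `ℝᵈ = EuclideanSpace ℝ (Fin d)` with `v = eⱼ`, `rieszSymbol j = rieszSymbolDir eⱼ`; the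
   symbol `rⱼ • 1` acts componentwise and sup-norm bookkeeping (`eLpNorm_pi_le_sum`, tree)
   gives the constant `k·C` (`rieszTransform_isLpMultiplier_holds`).

## Design notes

* Steps 1–6 are stated on a finite-dimensional real inner product space `E` with its Lebesgue
  measure `volume`, for a direction `v` (with `‖v‖ ≤ 1` where a uniform constant is wanted).
* The constants (`rieszIntegrandBound`, `rieszHormanderConst`, `rieszHormanderBound`) are
  explicit but immaterial; only finiteness is used.
* No named facts are introduced: every `def` below is a concrete kernel, symbol or constant.

## References

* [Grafakos2014] L. Grafakos, *Classical Fourier Analysis*, 3rd ed., GTM 249 (2014): Def. 5.1.13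
  and Prop. 5.1.14 (PDF p. 315), Thm. 5.2.7 and Cor. 5.2.8 (PDF pp. 327–329), Thm. 5.3.3
  (PDF p. 346).
* [Stein1971] E. M. Stein, *Singular integrals and differentiability properties of functions*,
  Princeton (1970): Ch. II §2.2 Thm 1, §3.2 Thm 2, §4.2 Thm 3 (PDF p. 36); Ch. III §1.2 (5), (8)
  (PDF pp. 51–52: the Riesz transforms and their multipliers); Ch. III §2.1 (α), (β) (PDF pp.
  54–55) and §3.4 (PDF p. 66) (subordination to Gaussians,
  `∫_0^∞ e^{-πδ|x|²}δ^{β-1} dδ = (π|x|²)^{-β}Γ(β)`).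
-/

noncomputable section

open MeasureTheory Set Filter Topology FourierTransform Real
open scoped ENNReal NNReal RealInnerProductSpace

namespace Literature.Analysis.Fourier

open Literature.Analysis.UnboundedOperators

variable {E : Type*} [NormedAddCommGroup E] [InnerProductSpace ℝ E]

/-- The directional derivative of the heat kernel, `∂ᵥK_t(x) = -(K_t(x)/(2t)) ⟪x, v⟫`
(meaningful for `t > 0`; at `t = 0` the junk convention `a/0 = 0` makes it `0`). [folklore] -/
def heatKernelDeriv (v : E) (t : ℝ) (x : E) : ℝ :=
  -(heatKernel t x / (2 * t)) * ⟪x, v⟫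

/-- `DK_t(x)[v] = ∂ᵥK_t(x)`. [folklore] -/
theorem fderiv_heatKernel_apply_eq_heatKernelDeriv (t : ℝ) (x v : E) :
    fderiv ℝ (heatKernel t) x v = heatKernelDeriv v t x := by
  rw [(hasFDerivAt_heatKernel t x).fderiv]
  simp only [FunLike.coe_smul, Pi.smul_apply, innerSL_apply_apply, smul_eq_mul]
  rfl

/-- Gaussian bound `|∂ᵥK_t(x)| ≤ (4πt)^{-n/2} t^{-1/2} e^{-‖x‖²/(8t)} ‖v‖` (`t > 0`). [folklore] -/
theorem abs_heatKernelDeriv_le {t : ℝ} (ht : 0 < t) (v x : E) :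
    |heatKernelDeriv v t x| ≤
      (4 * π * t) ^ (-(Module.finrank ℝ E : ℝ) / 2) * (√t)⁻¹ *
        rexp (-(1 / (8 * t)) * ‖x‖ ^ 2) * ‖v‖ := by
  rw [← fderiv_heatKernel_apply_eq_heatKernelDeriv, ← Real.norm_eq_abs]
  exact (ContinuousLinearMap.le_opNorm _ _).trans
    (mul_le_mul_of_nonneg_right (norm_fderiv_heatKernel_le ht x) (norm_nonneg _))

/-- The subordination integrand `t^{-1/2} ∂ᵥK_t(x)` (meaningful for `t > 0`). [folklore] -/
def rieszIntegrand (v : E) (t : ℝ) (x : E) : ℝ :=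
  t ^ (-(1 / 2 : ℝ)) * heatKernelDeriv v t x

/-- The subordination integrand is jointly measurable in `(t, x)`. [folklore] -/
theorem measurable_rieszIntegrand [MeasurableSpace E] [BorelSpace E] [SecondCountableTopology E] (v : E) :
    Measurable (fun p : ℝ × E => rieszIntegrand v p.1 p.2) := by
  unfold rieszIntegrand heatKernelDeriv heatKernel
  fun_prop

/-- The constant `ε^{-1/2} (4πε)^{-n/2} ε^{-1/2}` bounding the subordination integrand on `t ≥ ε`.
[folklore] -/
def rieszIntegrandBound (E : Type*) [NormedAddCommGroup E] [InnerProductSpace ℝ E] (ε : ℝ) : ℝ :=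
  ε ^ (-(1 / 2 : ℝ)) * ((4 * π * ε) ^ (-(Module.finrank ℝ E : ℝ) / 2) * (√ε)⁻¹)

/-- On `t ∈ [ε, R]`: `|t^{-1/2}∂ᵥK_t(x)| ≤ C_ε e^{-‖x‖²/(8R)} ‖v‖`. [folklore] -/
theorem abs_rieszIntegrand_le {ε R t : ℝ} (hε : 0 < ε) (ht : t ∈ Icc ε R) (v x : E) :
    |rieszIntegrand v t x| ≤ rieszIntegrandBound E ε * rexp (-(1 / (8 * R)) * ‖x‖ ^ 2) * ‖v‖ := by
  have ht0 : 0 < t := hε.trans_le ht.1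
  have hR : 0 < R := ht0.trans_le ht.2
  rw [rieszIntegrand, abs_mul, abs_of_nonneg (by positivity)]
  have h1 : t ^ (-(1 / 2 : ℝ)) ≤ ε ^ (-(1 / 2 : ℝ)) :=
    Real.rpow_le_rpow_of_nonpos hε ht.1 (by norm_num)
  have h2 : (4 * π * t) ^ (-(Module.finrank ℝ E : ℝ) / 2) ≤ (4 * π * ε) ^ (-(Module.finrank ℝ E : ℝ) / 2) :=
    Real.rpow_le_rpow_of_nonpos (by positivity) (by nlinarith [Real.pi_pos, ht.1]) (by
      have : (0 : ℝ) ≤ Module.finrank ℝ E := Nat.cast_nonneg _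
      linarith [div_nonneg this zero_le_two])
  have h3 : (√t)⁻¹ ≤ (√ε)⁻¹ := by
    rw [inv_le_inv₀ (Real.sqrt_pos.2 ht0) (Real.sqrt_pos.2 hε)]
    exact Real.sqrt_le_sqrt ht.1
  have h4 : rexp (-(1 / (8 * t)) * ‖x‖ ^ 2) ≤ rexp (-(1 / (8 * R)) * ‖x‖ ^ 2) := by
    rw [Real.exp_le_exp]
    have : 1 / (8 * R) ≤ 1 / (8 * t) := one_div_le_one_div_of_le (by positivity) (by linarith [ht.2])
    nlinarith [sq_nonneg ‖x‖]
  calc t ^ (-(1 / 2 : ℝ)) * |heatKernelDeriv v t x|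
      ≤ ε ^ (-(1 / 2 : ℝ)) * ((4 * π * t) ^ (-(Module.finrank ℝ E : ℝ) / 2) * (√t)⁻¹ *
        rexp (-(1 / (8 * t)) * ‖x‖ ^ 2) * ‖v‖) := by
        gcongr
        exact abs_heatKernelDeriv_le ht0 v x
    _ ≤ ε ^ (-(1 / 2 : ℝ)) * ((4 * π * ε) ^ (-(Module.finrank ℝ E : ℝ) / 2) * (√ε)⁻¹ *
        rexp (-(1 / (8 * R)) * ‖x‖ ^ 2) * ‖v‖) := by
        gcongr
    _ = rieszIntegrandBound E ε * rexp (-(1 / (8 * R)) * ‖x‖ ^ 2) * ‖v‖ := by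
        rw [rieszIntegrandBound]; ring


section Prod

variable [FiniteDimensional ℝ E] [MeasurableSpace E] [BorelSpace E]

/-- The subordination integrand is integrable on `[ε, R] × E` (`0 < ε ≤ R`): dominated by a
constant times a Gaussian. This is the workhorse behind the integrability of `k_{ε,R}` and the
Fubini computation of its Fourier transform. [folklore] -/
theorem integrable_rieszIntegrand_prod (v : E) {ε R : ℝ} (hε : 0 < ε) (hR : ε ≤ R) :
    Integrable (fun p : ℝ × E => rieszIntegrand v p.1 p.2)
      ((volume.restrict (Icc ε R)).prod volume) := by
  have hR0 : 0 < R := hε.trans_le hR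
  have hb : 0 < 1 / (8 * R) := by positivity
  have hdom : Integrable (fun p : ℝ × E => (rieszIntegrandBound E ε * ‖v‖) *
      rexp (-(1 / (8 * R)) * ‖p.2‖ ^ 2)) ((volume.restrict (Icc ε R)).prod volume) :=
    Integrable.mul_prod (integrable_const _) (integrable_gaussian_of_pos hb)
  refine hdom.mono' (measurable_rieszIntegrand v).aestronglyMeasurable ?_
  rw [Measure.restrict_prod_eq_prod_univ]
  refine (ae_restrict_iff' (measurableSet_Icc.prod MeasurableSet.univ)).2
    (Eventually.of_forall fun p hp => ?_)
  rw [Real.norm_eq_abs]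
  calc |rieszIntegrand v p.1 p.2|
      ≤ rieszIntegrandBound E ε * rexp (-(1 / (8 * R)) * ‖p.2‖ ^ 2) * ‖v‖ :=
        abs_rieszIntegrand_le hε hp.1 v p.2
    _ = rieszIntegrandBound E ε * ‖v‖ * rexp (-(1 / (8 * R)) * ‖p.2‖ ^ 2) := by ring

end Prod

/-! ### The truncated, heat-subordinated Riesz kernel -/

/-- The truncated, heat-subordinated Riesz kernel in the direction `v`,
`k_{ε,R}(x) = -(1/√π) ∫_{t ∈ [ε,R]} t^{-1/2} ∂ᵥK_t(x) dt` (meaningful for `0 < ε ≤ R`; the set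
integral over an empty `[ε, R]` is `0`). [folklore] -/
def rieszKernelTrunc (v : E) (ε R : ℝ) (x : E) : ℝ :=
  -(1 / √π) * ∫ t in Icc ε R, rieszIntegrand v t x

/-- `k_{ε,R}` is bounded: `|k_{ε,R}(x)| ≤ π^{-1/2} C_ε ‖v‖ (R - ε)`. [folklore] -/
theorem abs_rieszKernelTrunc_le {ε R : ℝ} (hε : 0 < ε) (hR : ε ≤ R) (v x : E) :
    |rieszKernelTrunc v ε R x| ≤ (1 / √π) * (rieszIntegrandBound E ε * ‖v‖ * (R - ε)) := by
  rw [rieszKernelTrunc, abs_mul, abs_neg, abs_of_nonneg (by positivity)]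
  refine mul_le_mul_of_nonneg_left ?_ (by positivity)
  have hR0 : 0 < R := hε.trans_le hR
  have h := norm_setIntegral_le_of_norm_le_const (μ := volume) (s := Icc ε R)
    (f := fun t => rieszIntegrand v t x) (C := rieszIntegrandBound E ε * ‖v‖)
    measure_Icc_lt_top (fun t ht => by
      rw [Real.norm_eq_abs]
      refine (abs_rieszIntegrand_le hε ht v x).trans ?_
      have h1 : rexp (-(1 / (8 * R)) * ‖x‖ ^ 2) ≤ 1 := by
        rw [Real.exp_le_one_iff]
        have : 0 ≤ 1 / (8 * R) * ‖x‖ ^ 2 := by positivity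
        linarith
      have h0 : 0 ≤ rieszIntegrandBound E ε := by rw [rieszIntegrandBound]; positivity
      calc rieszIntegrandBound E ε * rexp (-(1 / (8 * R)) * ‖x‖ ^ 2) * ‖v‖
          ≤ rieszIntegrandBound E ε * 1 * ‖v‖ := by gcongr
        _ = rieszIntegrandBound E ε * ‖v‖ := by ring)
  rw [Real.norm_eq_abs, measureReal_def, Real.volume_Icc,
    ENNReal.toReal_ofReal (by linarith)] at h
  exact h

section Kernel

variable [FiniteDimensional ℝ E] [MeasurableSpace E] [BorelSpace E]

/-- `k_{ε,R}` is integrable (`0 < ε ≤ R`). [folklore] -/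
theorem integrable_rieszKernelTrunc (v : E) {ε R : ℝ} (hε : 0 < ε) (hR : ε ≤ R) :
    Integrable (rieszKernelTrunc v ε R) := by
  have h := Integrable.integral_prod_right (μ := volume.restrict (Icc ε R))
    (ν := (volume : Measure E)) (integrable_rieszIntegrand_prod v hε hR)
  exact h.const_mul (-(1 / √π))

/-- `k_{ε,R}` is measurable. [folklore] -/
theorem measurable_rieszKernelTrunc (v : E) (ε R : ℝ) : Measurable (rieszKernelTrunc v ε R) := by
  have h : StronglyMeasurable (fun x : E => ∫ t, rieszIntegrand v t x ∂(volume.restrict (Icc ε R))) :=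
    StronglyMeasurable.integral_prod_right' (ν := volume.restrict (Icc ε R))
      (f := fun p : E × ℝ => rieszIntegrand v p.2 p.1)
      ((measurable_rieszIntegrand v).comp measurable_swap).stronglyMeasurable
  exact measurable_const.mul h.measurable

end Kernel

/-! ### Fourier transforms -/

section FourierKernel

variable [FiniteDimensional ℝ E] [MeasurableSpace E] [BorelSpace E]

/-- **`𝓕(∂ᵥK_t)(ξ) = 2πi⟪ξ, v⟫ e^{-4π²t‖ξ‖²}`** (`t > 0`; Mathlib's convention
`𝓕f(ξ) = ∫ e^{-2πi⟨x,ξ⟩} f(x) dx`): `Real.fourier_fderiv` for the complexified heat kernel and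
`𝓕K_t = e^{-4π²t‖ξ‖²}` (`fourierIntegral_heatKernel_holds`). (The same computation for the tree's
second copy of the heat kernel is `FunctionSpaces.BMOInv.fourier_ofReal_inner_heatKernelGrad`.)
[folklore] -/
theorem fourier_ofReal_heatKernelDeriv {t : ℝ} (ht : 0 < t) (v ξ : E) :
    𝓕 (fun x : E => (heatKernelDeriv v t x : ℂ)) ξ =
      2 * π * Complex.I * (⟪ξ, v⟫ : ℝ) * (heatSymbol t ξ : ℝ) := by
  -- the complexified kernel, its derivative, and their integrability
  have hder : ∀ w : E, HasFDerivAt (fun w : E => (heatKernel t w : ℂ))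
      (Complex.ofRealCLM.comp (fderiv ℝ (heatKernel t) w)) w := fun w =>
    Complex.ofRealCLM.hasFDerivAt.comp w (hasFDerivAt_heatKernel t w).differentiableAt.hasFDerivAt
  have hfd : fderiv ℝ (fun w : E => (heatKernel t w : ℂ)) =
      fun w => Complex.ofRealCLM.comp (fderiv ℝ (heatKernel t) w) :=
    funext fun w => (hder w).fderiv
  have hint : Integrable (fun w : E => (heatKernel t w : ℂ)) :=
    (integrable_heatKernel_holds ht).ofReal
  have hint1 : Integrable (fderiv ℝ (heatKernel (E := E) t)) := by
    refine ⟨(continuous_fderiv_heatKernel t).aestronglyMeasurable, ?_⟩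
    rw [hasFiniteIntegral_iff_enorm]
    exact (lintegral_enorm_fderiv_heatKernel_le (E := E) ht).trans_lt ENNReal.ofReal_lt_top
  have hint2 : Integrable (fderiv ℝ (fun w : E => (heatKernel t w : ℂ))) := by
    rw [hfd]
    refine hint1.norm.mono' ?_ (Eventually.of_forall fun w => ?_)
    · exact (continuous_const.clm_comp (continuous_fderiv_heatKernel t)).aestronglyMeasurable
    · refine ContinuousLinearMap.opNorm_le_bound _ (norm_nonneg _) fun u => ?_
      rw [ContinuousLinearMap.comp_apply, Complex.ofRealCLM_apply, Complex.norm_real]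
      exact ContinuousLinearMap.le_opNorm _ _
  -- the computation
  have h1 : (fun x : E => (heatKernelDeriv v t x : ℂ)) =
      fun x => fderiv ℝ (fun w : E => (heatKernel t w : ℂ)) x v := by
    funext x
    rw [hfd]
    simp only [ContinuousLinearMap.comp_apply, Complex.ofRealCLM_apply,
      fderiv_heatKernel_apply_eq_heatKernelDeriv]
  have hdiff : Differentiable ℝ (fun w : E => (heatKernel t w : ℂ)) :=
    fun w => (hder w).differentiableAt
  rw [h1, ← Real.fourier_continuousLinearMap_apply hint2, Real.fourier_fderiv hint hdiff hint2,
    VectorFourier.fourierSMulRight_apply, fourierIntegral_heatKernel_holds ht ξ]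
  rw [neg_apply, neg_apply, innerSL_apply_apply]
  simp only [smul_eq_mul, neg_mul, neg_smul, Complex.real_smul]
  ring

/-- `𝓕(t^{-1/2}∂ᵥK_t)(ξ) = t^{-1/2} · 2πi⟪ξ, v⟫ e^{-4π²t‖ξ‖²}`. [folklore] -/
theorem fourier_ofReal_rieszIntegrand {t : ℝ} (ht : 0 < t) (v ξ : E) :
    𝓕 (fun x : E => (rieszIntegrand v t x : ℂ)) ξ =
      ((t ^ (-(1 / 2 : ℝ)) : ℝ) : ℂ) * (2 * π * Complex.I * (⟪ξ, v⟫ : ℝ) * (heatSymbol t ξ : ℝ)) := by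
  rw [← fourier_ofReal_heatKernelDeriv ht v ξ]
  simp only [Real.fourier_eq, Circle.smul_def, rieszIntegrand, Complex.ofReal_mul]
  rw [← integral_const_mul]
  congr 1
  funext x
  ring

end FourierKernel

/-! ### The truncated symbol -/

/-- The subordination integral `S(ε, R, a) = ∫_{[ε,R]} t^{-1/2} e^{-at} dt` (meaningful for
`0 < ε ≤ R`, `0 ≤ a`). [folklore] -/
def subordIntegral (ε R a : ℝ) : ℝ :=
  ∫ t in Icc ε R, t ^ (-(1 / 2 : ℝ)) * rexp (-(a * t))

/-- The symbol of `k_{ε,R}`: `m_{ε,R}(ξ) = -2√π i ⟪ξ, v⟫ S(ε, R, 4π²‖ξ‖²)` (its Fourier transform,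
`fourier_ofReal_rieszKernelTrunc`). [folklore] -/
def rieszSymbolTrunc (v : E) (ε R : ℝ) (ξ : E) : ℂ :=
  -((2 * √π * ⟪ξ, v⟫ * subordIntegral ε R (4 * π ^ 2 * ‖ξ‖ ^ 2) : ℝ) : ℂ) * Complex.I

section FourierTrunc

variable [FiniteDimensional ℝ E] [MeasurableSpace E] [BorelSpace E]

/-- **`𝓕 k_{ε,R} = m_{ε,R}`** (Fubini in `(t, x)`). [folklore] -/
theorem fourier_ofReal_rieszKernelTrunc (v : E) {ε R : ℝ} (hε : 0 < ε) (hR : ε ≤ R) (ξ : E) :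
    𝓕 (fun x : E => (rieszKernelTrunc v ε R x : ℂ)) ξ = rieszSymbolTrunc v ε R ξ := by
  set μ : Measure ℝ := volume.restrict (Icc ε R) with hμ
  have hprod := integrable_rieszIntegrand_prod v hε hR
  -- the character
  have hchar : Continuous fun x : E => ((𝐞 (-⟪x, ξ⟫) : Circle) : ℂ) :=
    continuous_subtype_val.comp
      (Real.continuous_fourierChar.comp (continuous_id.inner continuous_const).neg)
  -- integrability of the double integrand
  have hG : Integrable (Function.uncurry fun (x : E) (t : ℝ) =>
      ((𝐞 (-⟪x, ξ⟫) : Circle) : ℂ) * (rieszIntegrand v t x : ℂ)) ((volume : Measure E).prod μ) := by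
    have h1 : Integrable (fun p : E × ℝ => (rieszIntegrand v p.2 p.1 : ℂ)) ((volume : Measure E).prod μ) :=
      (hprod.swap).ofReal
    refine h1.bdd_mul (c := 1) ?_ (Eventually.of_forall fun p => ?_)
    · exact (hchar.comp continuous_fst).aestronglyMeasurable
    · simp only [Circle.norm_coe, le_refl]
  -- the scalar identity `(1/√π)·2π = 2√π`
  have hr : -(1 / √π) * (2 * π) = -(2 * √π) := by
    have hπ : √π * √π = π := Real.mul_self_sqrt Real.pi_pos.le
    have hne : √π ≠ 0 := (Real.sqrt_pos.2 Real.pi_pos).ne'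
    field_simp
    linarith
  calc 𝓕 (fun x : E => (rieszKernelTrunc v ε R x : ℂ)) ξ
      = ∫ x, ((𝐞 (-⟪x, ξ⟫) : Circle) : ℂ) *
          ((-(1 / √π) : ℝ) * ∫ t, (rieszIntegrand v t x : ℂ) ∂μ) := by
        rw [Real.fourier_eq]
        congr 1
        funext x
        rw [Circle.smul_def, smul_eq_mul, rieszKernelTrunc, Complex.ofReal_mul, integral_complex_ofReal]
    _ = (-(1 / √π) : ℝ) * ∫ x, (∫ t, ((𝐞 (-⟪x, ξ⟫) : Circle) : ℂ) * (rieszIntegrand v t x : ℂ) ∂μ) := by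
        rw [← integral_const_mul]
        congr 1
        funext x
        rw [mul_left_comm, ← integral_const_mul]
    _ = (-(1 / √π) : ℝ) * ∫ t, (∫ x, ((𝐞 (-⟪x, ξ⟫) : Circle) : ℂ) * (rieszIntegrand v t x : ℂ)) ∂μ := by
        rw [integral_integral_swap hG]
    _ = (-(1 / √π) : ℝ) * ∫ t, ((t ^ (-(1 / 2 : ℝ)) : ℝ) : ℂ) *
          (2 * π * Complex.I * (⟪ξ, v⟫ : ℝ) * (heatSymbol t ξ : ℝ)) ∂μ := by
        congr 1
        refine setIntegral_congr_fun measurableSet_Icc fun t ht => ?_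
        have ht0 : 0 < t := hε.trans_le ht.1
        rw [← fourier_ofReal_rieszIntegrand ht0 v ξ, Real.fourier_eq]
        simp only [Circle.smul_def, smul_eq_mul]
    _ = (-(1 / √π) : ℝ) * ((2 * π * Complex.I * (⟪ξ, v⟫ : ℝ)) *
          ((subordIntegral ε R (4 * π ^ 2 * ‖ξ‖ ^ 2) : ℝ) : ℂ)) := by
        congr 1
        rw [subordIntegral, ← integral_complex_ofReal, ← integral_const_mul]
        refine setIntegral_congr_fun measurableSet_Icc fun t _ => ?_
        rw [heatSymbol]
        have : -(2 * π) ^ 2 * t * ‖ξ‖ ^ 2 = -(4 * π ^ 2 * ‖ξ‖ ^ 2 * t) := by ring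
        rw [this]
        push_cast
        ring
    _ = (((-(1 / √π) * (2 * π)) * ⟪ξ, v⟫ * subordIntegral ε R (4 * π ^ 2 * ‖ξ‖ ^ 2) : ℝ) : ℂ) *
          Complex.I := by
        push_cast
        ring
    _ = rieszSymbolTrunc v ε R ξ := by
        rw [hr, rieszSymbolTrunc]
        push_cast
        ring

end FourierTrunc

/-! ### The subordination integral: bounds and limit -/

section Subord

/-- `t^{-1/2} e^{-at}` is integrable on `(0, ∞)` for `a > 0`. [folklore] -/
theorem integrableOn_subordIntegrand {a : ℝ} (ha : 0 < a) :
    IntegrableOn (fun t : ℝ => t ^ (-(1 / 2 : ℝ)) * rexp (-(a * t))) (Ioi 0) := by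
  have h := integrableOn_rpow_mul_exp_neg_mul_rpow (s := -(1 / 2 : ℝ)) (p := 1)
    (by norm_num) le_rfl ha
  refine h.congr_fun (fun t _ => ?_) measurableSet_Ioi
  simp only [Real.rpow_one, neg_mul]

/-- `∫_0^∞ t^{-1/2} e^{-at} dt = Γ(1/2) a^{-1/2} = √π a^{-1/2}` (`a > 0`). [folklore] -/
theorem integral_subordIntegrand_Ioi {a : ℝ} (ha : 0 < a) :
    ∫ t in Ioi 0, t ^ (-(1 / 2 : ℝ)) * rexp (-(a * t)) = √π * a ^ (-(1 / 2 : ℝ)) := by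
  have h := integral_rpow_mul_exp_neg_mul_Ioi (a := 1 / 2) (r := a) (by norm_num) ha
  rw [show (1 / 2 : ℝ) - 1 = -(1 / 2) by norm_num, Real.Gamma_one_half_eq] at h
  rw [h, one_div, Real.inv_rpow ha.le, Real.rpow_neg ha.le, mul_comm]

/-- `0 ≤ S(ε, R, a)` for `ε > 0`. [folklore] -/
theorem subordIntegral_nonneg {ε : ℝ} (hε : 0 < ε) (R a : ℝ) : 0 ≤ subordIntegral ε R a :=
  setIntegral_nonneg measurableSet_Icc fun _ ht =>
    mul_nonneg (Real.rpow_nonneg (hε.le.trans ht.1) _) (Real.exp_nonneg _)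

/-- `S(ε, R, a) ≤ √π a^{-1/2}` for `ε, a > 0`. [folklore] -/
theorem subordIntegral_le {ε : ℝ} (hε : 0 < ε) (R : ℝ) {a : ℝ} (ha : 0 < a) :
    subordIntegral ε R a ≤ √π * a ^ (-(1 / 2 : ℝ)) := by
  rw [subordIntegral, ← integral_subordIntegrand_Ioi ha]
  refine setIntegral_mono_set (integrableOn_subordIntegrand ha) ?_
    ((show Icc ε R ≤ Ioi 0 from fun t ht => hε.trans_le ht.1).eventuallyLE)
  refine (ae_restrict_iff' measurableSet_Ioi).2 (Eventually.of_forall fun t ht => ?_)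
  exact mul_nonneg (Real.rpow_nonneg (le_of_lt ht) _) (Real.exp_nonneg _)

/-- The exhaustion `⋃ₙ [1/(n+1), n+1] = (0, ∞)`. [folklore] -/
theorem iUnion_Icc_eq_Ioi :
    (⋃ n : ℕ, Icc (1 / ((n : ℝ) + 1)) ((n : ℝ) + 1)) = Ioi 0 := by
  ext t
  simp only [mem_iUnion, mem_Icc, mem_Ioi]
  constructor
  · rintro ⟨n, hn, -⟩
    exact lt_of_lt_of_le (by positivity) hn
  · intro ht
    obtain ⟨n, hn⟩ := exists_nat_ge (max (1 / t) t)
    refine ⟨n, ?_, (le_max_right _ _).trans (hn.trans (by linarith))⟩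
    rw [div_le_iff₀ (by positivity)]
    have h1 : 1 / t ≤ n := (le_max_left _ _).trans hn
    rw [div_le_iff₀ ht] at h1
    nlinarith

/-- `S(1/(n+1), n+1, a) → √π a^{-1/2}` (`a > 0`). [folklore] -/
theorem tendsto_subordIntegral {a : ℝ} (ha : 0 < a) :
    Tendsto (fun n : ℕ => subordIntegral (1 / ((n : ℝ) + 1)) ((n : ℝ) + 1) a) atTop
      (𝓝 (√π * a ^ (-(1 / 2 : ℝ)))) := by
  rw [← integral_subordIntegrand_Ioi ha, ← iUnion_Icc_eq_Ioi]
  refine tendsto_setIntegral_of_monotone (μ := volume)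
    (s := fun n : ℕ => Icc (1 / ((n : ℝ) + 1)) ((n : ℝ) + 1)) (fun n => measurableSet_Icc)
    (fun n m hnm => Icc_subset_Icc ?_ ?_) ?_
  · exact one_div_le_one_div_of_le (by positivity) (by exact_mod_cast Nat.add_le_add_right hnm 1)
  · exact_mod_cast Nat.add_le_add_right hnm 1
  · rw [iUnion_Icc_eq_Ioi]
    exact integrableOn_subordIntegrand ha

end Subord

/-! ### The truncated symbols: uniform bound and limit -/

omit [InnerProductSpace ℝ E] in
/-- `(4π²‖ξ‖²)^{-1/2} = (2π‖ξ‖)⁻¹`. [folklore] -/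
theorem rpow_neg_half_four_pi_sq (ξ : E) :
    (4 * π ^ 2 * ‖ξ‖ ^ 2) ^ (-(1 / 2 : ℝ)) = (2 * π * ‖ξ‖)⁻¹ := by
  have h0 : 0 ≤ 2 * π * ‖ξ‖ := by positivity
  rw [show 4 * π ^ 2 * ‖ξ‖ ^ 2 = (2 * π * ‖ξ‖) ^ 2 by ring, ← Real.rpow_two, ← Real.rpow_mul h0,
    show (2 : ℝ) * (-(1 / 2)) = -1 by norm_num, Real.rpow_neg_one]

/-- The key scalar identity `2√π s (√π (2π r)⁻¹) = s / r`. [folklore] -/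
theorem two_sqrt_pi_mul_eq (s : ℝ) {r : ℝ} (hr : r ≠ 0) :
    2 * √π * s * (√π * (2 * π * r)⁻¹) = s / r := by
  have hπ : √π * √π = π := Real.mul_self_sqrt Real.pi_pos.le
  calc 2 * √π * s * (√π * (2 * π * r)⁻¹) = (√π * √π) * s * (π * r)⁻¹ := by ring
    _ = π * s * (π * r)⁻¹ := by rw [hπ]
    _ = s / r := by field_simp

/-- **Uniform bound `‖m_{ε,R}(ξ)‖ ≤ ‖v‖`** (the `L²` constant of the truncations is `1` for
unit `v`; positivity of the subordination integrand). [folklore] -/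
theorem norm_rieszSymbolTrunc_le {ε : ℝ} (hε : 0 < ε) (R : ℝ) (v ξ : E) :
    ‖rieszSymbolTrunc v ε R ξ‖ ≤ ‖v‖ := by
  rw [rieszSymbolTrunc, norm_mul, norm_neg, Complex.norm_real, Complex.norm_I, mul_one,
    Real.norm_eq_abs]
  rcases eq_or_ne ξ 0 with rfl | hξ
  · simp
  have hn : 0 < ‖ξ‖ := norm_pos_iff.2 hξ
  have ha : 0 < 4 * π ^ 2 * ‖ξ‖ ^ 2 := by positivity
  have hS0 := subordIntegral_nonneg hε R (4 * π ^ 2 * ‖ξ‖ ^ 2)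
  have hS := subordIntegral_le hε R ha
  rw [rpow_neg_half_four_pi_sq] at hS
  rw [abs_mul, abs_mul, abs_of_pos (by positivity : 0 < 2 * √π), abs_of_nonneg hS0]
  calc 2 * √π * |⟪ξ, v⟫| * subordIntegral ε R (4 * π ^ 2 * ‖ξ‖ ^ 2)
      ≤ 2 * √π * |⟪ξ, v⟫| * (√π * (2 * π * ‖ξ‖)⁻¹) := by gcongr
    _ = |⟪ξ, v⟫| / ‖ξ‖ := two_sqrt_pi_mul_eq _ hn.ne'
    _ ≤ ‖v‖ := by
        rw [div_le_iff₀ hn]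
        calc |⟪ξ, v⟫| ≤ ‖ξ‖ * ‖v‖ := abs_real_inner_le_norm ξ v
          _ = ‖v‖ * ‖ξ‖ := mul_comm _ _

/-- The symbol `-i⟪ξ, v⟫/‖ξ‖` of the Riesz transform in the direction `v` (value `0` at
`ξ = 0`). [folklore] -/
def rieszSymbolDir (v ξ : E) : ℂ :=
  -((⟪ξ, v⟫ / ‖ξ‖ : ℝ) : ℂ) * Complex.I

/-- `‖rieszSymbolDir v ξ‖ ≤ ‖v‖`. [folklore] -/
theorem norm_rieszSymbolDir_le (v ξ : E) : ‖rieszSymbolDir v ξ‖ ≤ ‖v‖ := by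
  rw [rieszSymbolDir, norm_mul, norm_neg, Complex.norm_real, Complex.norm_I, mul_one,
    Real.norm_eq_abs, abs_div, abs_norm]
  rcases eq_or_ne ξ 0 with rfl | hξ
  · simp
  rw [div_le_iff₀ (norm_pos_iff.2 hξ)]
  calc |⟪ξ, v⟫| ≤ ‖ξ‖ * ‖v‖ := abs_real_inner_le_norm ξ v
    _ = ‖v‖ * ‖ξ‖ := mul_comm _ _

/-- **`m_{1/(n+1), n+1}(ξ) → -i⟪ξ, v⟫/‖ξ‖`** for `ξ ≠ 0`. [folklore] -/
theorem tendsto_rieszSymbolTrunc (v : E) {ξ : E} (hξ : ξ ≠ 0) :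
    Tendsto (fun n : ℕ => rieszSymbolTrunc v (1 / ((n : ℝ) + 1)) ((n : ℝ) + 1) ξ) atTop
      (𝓝 (rieszSymbolDir v ξ)) := by
  have hn : 0 < ‖ξ‖ := norm_pos_iff.2 hξ
  have ha : 0 < 4 * π ^ 2 * ‖ξ‖ ^ 2 := by positivity
  have h := tendsto_subordIntegral ha
  rw [rpow_neg_half_four_pi_sq] at h
  have hcont : Continuous fun S : ℝ => -((2 * √π * ⟪ξ, v⟫ * S : ℝ) : ℂ) * Complex.I := by
    fun_prop
  have h3 := (hcont.tendsto _).comp h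
  rw [two_sqrt_pi_mul_eq _ hn.ne'] at h3
  exact h3

/-! ### Hörmander's condition for the truncated kernels, uniformly in the truncation -/

section Hessian

/-- `1/2 + u ≤ e^{u/2}` for `u ≥ 0` (from `1 + x + x²/2 ≤ eˣ`). [folklore] -/
theorem half_add_le_exp_half {u : ℝ} (hu : 0 ≤ u) : 1 / 2 + u ≤ rexp (u / 2) := by
  have h := Real.quadratic_le_exp_of_nonneg (by positivity : 0 ≤ u / 2)
  nlinarith [sq_nonneg (u - 2)]

/-- The scalar inequality behind the Hessian bound of the heat kernel:
`e^{-r²/(4t)} (1/(2t) + r²/(4t²)) ≤ t⁻¹ e^{-r²/(8t)}` (`t > 0`). [folklore] -/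
theorem exp_mul_inv_add_sq_le {t : ℝ} (ht : 0 < t) (r : ℝ) :
    rexp (-(1 / (4 * t)) * r ^ 2) * (1 / (2 * t) + r ^ 2 / (4 * t ^ 2)) ≤
      t⁻¹ * rexp (-(1 / (8 * t)) * r ^ 2) := by
  set u : ℝ := r ^ 2 / (4 * t) with hu
  have hu0 : 0 ≤ u := by positivity
  have h1 : rexp (-(1 / (4 * t)) * r ^ 2) = rexp (-(u / 2)) * rexp (-(u / 2)) := by
    rw [← Real.exp_add]; congr 1; rw [hu]; field_simp; ring
  have h2 : rexp (-(1 / (8 * t)) * r ^ 2) = rexp (-(u / 2)) := by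
    congr 1; rw [hu]; field_simp; ring
  have h3 : 1 / (2 * t) + r ^ 2 / (4 * t ^ 2) = t⁻¹ * (1 / 2 + u) := by
    rw [hu]; field_simp
  rw [h1, h2, h3]
  have h4 : rexp (-(u / 2)) * (1 / 2 + u) ≤ 1 := by
    rw [Real.exp_neg, inv_mul_le_iff₀ (Real.exp_pos _), mul_one]
    exact half_add_le_exp_half hu0
  calc rexp (-(u / 2)) * rexp (-(u / 2)) * (t⁻¹ * (1 / 2 + u))
      = t⁻¹ * rexp (-(u / 2)) * (rexp (-(u / 2)) * (1 / 2 + u)) := by ring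
    _ ≤ t⁻¹ * rexp (-(u / 2)) * 1 := by gcongr
    _ = t⁻¹ * rexp (-(u / 2)) := mul_one _

/-- `∂ᵥK_t` is differentiable, with derivative
`w ↦ -(DK_t(z)w/(2t))⟪z, v⟫ - (K_t(z)/(2t))⟪w, v⟫`. [folklore] -/
theorem hasFDerivAt_heatKernelDeriv (v : E) (t : ℝ) (z : E) :
    HasFDerivAt (heatKernelDeriv v t)
      ((-(heatKernel t z / (2 * t))) • innerSL ℝ v +
        ⟪z, v⟫ • ((-(1 / (2 * t))) • ((-(heatKernel t z / (2 * t))) • innerSL ℝ z))) z := by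
  have hc : HasFDerivAt (fun w : E => -(heatKernel t w / (2 * t)))
      ((-(1 / (2 * t))) • ((-(heatKernel t z / (2 * t))) • innerSL ℝ z)) z := by
    have h := ((hasFDerivAt_heatKernel t z).const_smul (-(1 / (2 * t))))
    refine h.congr_of_eventuallyEq (Eventually.of_forall fun w => ?_)
    simp only [Pi.smul_apply, smul_eq_mul]
    ring
  have hd : HasFDerivAt (fun w : E => ⟪w, v⟫) (innerSL ℝ v) z := by
    refine ((innerSL ℝ v).hasFDerivAt (x := z)).congr_of_eventuallyEq
      (Eventually.of_forall fun w => ?_)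
    simp [real_inner_comm]
  exact hc.mul hd

/-- **Hessian bound for the heat kernel**:
`‖D(∂ᵥK_t)(z)‖ ≤ (4πt)^{-n/2} t⁻¹ e^{-‖z‖²/(8t)} ‖v‖` (`t > 0`). [folklore] -/
theorem norm_fderiv_heatKernelDeriv_le {t : ℝ} (ht : 0 < t) (v z : E) :
    ‖fderiv ℝ (heatKernelDeriv v t) z‖ ≤
      (4 * π * t) ^ (-(Module.finrank ℝ E : ℝ) / 2) * (t⁻¹ * rexp (-(1 / (8 * t)) * ‖z‖ ^ 2)) *
        ‖v‖ := by
  rw [(hasFDerivAt_heatKernelDeriv v t z).fderiv]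
  have hK : 0 < heatKernel t z := heatKernel_pos ht z
  have hn1 : ‖(-(heatKernel t z / (2 * t))) • innerSL ℝ v‖ ≤ heatKernel t z / (2 * t) * ‖v‖ := by
    rw [norm_smul, norm_neg, Real.norm_of_nonneg (by positivity), innerSL_apply_norm]
  have hn2 : ‖⟪z, v⟫ • ((-(1 / (2 * t))) • ((-(heatKernel t z / (2 * t))) • innerSL ℝ z))‖ ≤
      ‖z‖ * ‖v‖ * (1 / (2 * t) * (heatKernel t z / (2 * t) * ‖z‖)) := by
    rw [norm_smul, norm_smul, norm_smul, norm_neg, norm_neg,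
      Real.norm_of_nonneg (r := 1 / (2 * t)) (by positivity),
      Real.norm_of_nonneg (r := heatKernel t z / (2 * t)) (by positivity), innerSL_apply_norm,
      Real.norm_eq_abs]
    gcongr
    exact abs_real_inner_le_norm z v
  calc ‖(-(heatKernel t z / (2 * t))) • innerSL ℝ v +
        ⟪z, v⟫ • ((-(1 / (2 * t))) • ((-(heatKernel t z / (2 * t))) • innerSL ℝ z))‖
      ≤ heatKernel t z / (2 * t) * ‖v‖ + ‖z‖ * ‖v‖ * (1 / (2 * t) * (heatKernel t z / (2 * t) * ‖z‖)) :=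
        (norm_add_le _ _).trans (add_le_add hn1 hn2)
    _ = heatKernel t z * (1 / (2 * t) + ‖z‖ ^ 2 / (4 * t ^ 2)) * ‖v‖ := by
        field_simp
        ring
    _ ≤ (4 * π * t) ^ (-(Module.finrank ℝ E : ℝ) / 2) * (t⁻¹ * rexp (-(1 / (8 * t)) * ‖z‖ ^ 2)) *
        ‖v‖ := by
        rw [heatKernel_eq]
        have h := exp_mul_inv_add_sq_le ht ‖z‖
        have h0 : 0 ≤ (4 * π * t) ^ (-(Module.finrank ℝ E : ℝ) / 2) := by positivity
        calc (4 * π * t) ^ (-(Module.finrank ℝ E : ℝ) / 2) * rexp (-(1 / (4 * t)) * ‖z‖ ^ 2) *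
              (1 / (2 * t) + ‖z‖ ^ 2 / (4 * t ^ 2)) * ‖v‖
            = (4 * π * t) ^ (-(Module.finrank ℝ E : ℝ) / 2) * (rexp (-(1 / (4 * t)) * ‖z‖ ^ 2) *
              (1 / (2 * t) + ‖z‖ ^ 2 / (4 * t ^ 2))) * ‖v‖ := by ring
          _ ≤ (4 * π * t) ^ (-(Module.finrank ℝ E : ℝ) / 2) *
              (t⁻¹ * rexp (-(1 / (8 * t)) * ‖z‖ ^ 2)) * ‖v‖ := by gcongr

/-- **Mean-value estimate off the diagonal**: for `2‖y‖ ≤ ‖x‖` and `t > 0`,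
`|∂ᵥK_t(x - y) - ∂ᵥK_t(x)| ≤ (4πt)^{-n/2} t⁻¹ e^{-‖x‖²/(32t)} ‖v‖ ‖y‖` (on the segment
`[x - y, x]` one has `‖z‖ ≥ ‖x‖/2`). [folklore] -/
theorem abs_heatKernelDeriv_sub_le {t : ℝ} (ht : 0 < t) (v : E) {x y : E} (hxy : 2 * ‖y‖ ≤ ‖x‖) :
    |heatKernelDeriv v t (x - y) - heatKernelDeriv v t x| ≤
      (4 * π * t) ^ (-(Module.finrank ℝ E : ℝ) / 2) * (t⁻¹ * rexp (-(1 / (32 * t)) * ‖x‖ ^ 2)) *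
        ‖v‖ * ‖y‖ := by
  set C : ℝ := (4 * π * t) ^ (-(Module.finrank ℝ E : ℝ) / 2) *
    (t⁻¹ * rexp (-(1 / (32 * t)) * ‖x‖ ^ 2)) * ‖v‖ with hC
  have hseg : ∀ z ∈ segment ℝ x (x - y), ‖x‖ / 2 ≤ ‖z‖ := by
    intro z hz
    rw [segment_eq_image'] at hz
    obtain ⟨θ, ⟨hθ0, hθ1⟩, rfl⟩ := hz
    have h1 : ‖x‖ ≤ ‖x + θ • (x - y - x)‖ + θ * ‖y‖ := by
      calc ‖x‖ = ‖(x + θ • (x - y - x)) - θ • (x - y - x)‖ := by rw [add_sub_cancel_right]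
        _ ≤ ‖x + θ • (x - y - x)‖ + ‖θ • (x - y - x)‖ := norm_sub_le _ _
        _ = ‖x + θ • (x - y - x)‖ + θ * ‖y‖ := by
            rw [norm_smul, Real.norm_of_nonneg hθ0, sub_sub_cancel_left, norm_neg]
    have h2 : θ * ‖y‖ ≤ ‖y‖ := mul_le_of_le_one_left (norm_nonneg _) hθ1
    linarith
  have hbound : ∀ z ∈ segment ℝ x (x - y), ‖fderiv ℝ (heatKernelDeriv v t) z‖ ≤ C := by
    intro z hz
    refine (norm_fderiv_heatKernelDeriv_le ht v z).trans ?_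
    rw [hC]
    gcongr (4 * π * t) ^ (-(Module.finrank ℝ E : ℝ) / 2) * (t⁻¹ * ?_) * ‖v‖
    rw [Real.exp_le_exp]
    have hz' := hseg z hz
    have hx2 : ‖x‖ ^ 2 / 4 ≤ ‖z‖ ^ 2 := by
      have h0 : 0 ≤ ‖x‖ / 2 := by positivity
      nlinarith [hz', h0]
    have : 1 / (32 * t) * ‖x‖ ^ 2 ≤ 1 / (8 * t) * ‖z‖ ^ 2 := by
      rw [show 1 / (32 * t) * ‖x‖ ^ 2 = 1 / (8 * t) * (‖x‖ ^ 2 / 4) by ring]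
      gcongr
    linarith
  have h := Convex.norm_image_sub_le_of_norm_fderiv_le (𝕜 := ℝ) (f := heatKernelDeriv v t)
    (fun z _ => (hasFDerivAt_heatKernelDeriv v t z).differentiableAt) hbound
    (convex_segment x (x - y)) (left_mem_segment ℝ x (x - y)) (right_mem_segment ℝ x (x - y))
  rw [Real.norm_eq_abs, sub_sub_cancel_left, norm_neg] at h
  exact h

end Hessian

/-! ### The time integral `∫₀^∞ t^{-α-1} e^{-c/t} dt = c^{-α} Γ(α)` -/

section TimeIntegral

/-- The substitution `t = x⁻¹`, pointwise. [folklore] -/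
theorem rpow_inv_subst {α c x : ℝ} (hx : 0 < x) :
    (|(-1 : ℝ)| * x ^ ((-1 : ℝ) - 1)) • ((x ^ (-1 : ℝ)) ^ (-α - 1) * rexp (-(c / x ^ (-1 : ℝ)))) =
      x ^ (α - 1) * rexp (-(c * x)) := by
  rw [Real.rpow_neg_one, smul_eq_mul, abs_neg, abs_one, one_mul]
  have h1 : (x⁻¹) ^ (-α - 1) = x ^ (α + 1) := by
    rw [Real.inv_rpow hx.le, show -α - 1 = -(α + 1) by ring, Real.rpow_neg hx.le, inv_inv]
  rw [h1, div_inv_eq_mul, ← mul_assoc, ← Real.rpow_add hx,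
    show (-1 : ℝ) - 1 + (α + 1) = α - 1 by ring]

/-- **`∫₀^∞ t^{-α-1} e^{-c/t} dt = c^{-α} Γ(α)`** (`α, c > 0`; substitute `t = x⁻¹`). [folklore] -/
theorem integral_rpow_mul_exp_neg_div_Ioi {α c : ℝ} (hα : 0 < α) (hc : 0 < c) :
    ∫ t in Ioi 0, t ^ (-α - 1) * rexp (-(c / t)) = c ^ (-α) * Real.Gamma α := by
  have h := integral_comp_rpow_Ioi (fun t => t ^ (-α - 1) * rexp (-(c / t))) (p := -1)
    (by norm_num)
  rw [← h]
  have h2 : ∫ x in Ioi (0 : ℝ), (|(-1 : ℝ)| * x ^ ((-1 : ℝ) - 1)) •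
        ((x ^ (-1 : ℝ)) ^ (-α - 1) * rexp (-(c / x ^ (-1 : ℝ)))) =
      ∫ x in Ioi (0 : ℝ), x ^ (α - 1) * rexp (-(c * x)) :=
    setIntegral_congr_fun measurableSet_Ioi fun x hx => rpow_inv_subst hx
  rw [h2, integral_rpow_mul_exp_neg_mul_Ioi hα hc, one_div, Real.inv_rpow hc.le,
    Real.rpow_neg hc.le]

/-- `t^{-α-1} e^{-c/t}` is integrable on `(0, ∞)` (`α, c > 0`). [folklore] -/
theorem integrableOn_rpow_mul_exp_neg_div {α c : ℝ} (hα : 0 < α) (hc : 0 < c) :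
    IntegrableOn (fun t : ℝ => t ^ (-α - 1) * rexp (-(c / t))) (Ioi 0) := by
  have h1 : IntegrableOn (fun x : ℝ => x ^ (α - 1) * rexp (-(c * x))) (Ioi 0) := by
    have h := integrableOn_rpow_mul_exp_neg_mul_rpow (s := α - 1) (p := 1) (by linarith) le_rfl hc
    refine h.congr_fun (fun t _ => ?_) measurableSet_Ioi
    simp only [Real.rpow_one, neg_mul]
  rw [← integrableOn_Ioi_comp_rpow_iff (fun t => t ^ (-α - 1) * rexp (-(c / t))) (p := -1)
    (by norm_num)]
  exact h1.congr_fun (fun x hx => (rpow_inv_subst hx).symm) measurableSet_Ioi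

end TimeIntegral

/-! ### The standard kernel estimate `|k(x-y) - k(x)| ≤ A ‖y‖ ‖x‖^{-n-1}`, `2‖y‖ ≤ ‖x‖` -/

/-- The constant `A_n = π^{-1/2} (4π)^{-n/2} 32^{(n+1)/2} Γ((n+1)/2)` of the standard estimate.
[folklore] -/
def rieszHormanderConst (n : ℕ) : ℝ :=
  1 / √π * ((4 * π) ^ (-(n : ℝ) / 2) *
    ((32 : ℝ) ^ (((n : ℝ) + 1) / 2) * Real.Gamma (((n : ℝ) + 1) / 2)))

/-- `0 ≤ A_n`. [folklore] -/
theorem rieszHormanderConst_nonneg (n : ℕ) : 0 ≤ rieszHormanderConst n := by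
  unfold rieszHormanderConst
  have : 0 ≤ Real.Gamma (((n : ℝ) + 1) / 2) := (Real.Gamma_pos_of_pos (by positivity)).le
  positivity

section KernelDifference

variable [MeasurableSpace E] [BorelSpace E] [SecondCountableTopology E]

/-- `t ↦ t^{-1/2}∂ᵥK_t(z)` is integrable on `[ε, R]` (`ε > 0`). [folklore] -/
theorem integrableOn_rieszIntegrand {ε : ℝ} (hε : 0 < ε) (R : ℝ) (v z : E) :
    IntegrableOn (fun t => rieszIntegrand v t z) (Icc ε R) := by
  refine Measure.integrableOn_of_bounded (M := rieszIntegrandBound E ε * 1 * ‖v‖)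
    measure_Icc_lt_top.ne ?_ ?_
  · exact ((measurable_rieszIntegrand v).comp
      (measurable_id.prodMk measurable_const)).aestronglyMeasurable
  · refine (ae_restrict_iff' measurableSet_Icc).2 (Eventually.of_forall fun t ht => ?_)
    rw [Real.norm_eq_abs]
    refine (abs_rieszIntegrand_le hε ht v z).trans ?_
    have hR : 0 < R := (hε.trans_le ht.1).trans_le ht.2
    gcongr
    · rw [rieszIntegrandBound]; positivity
    · rw [Real.exp_le_one_iff]
      have : 0 ≤ 1 / (8 * R) * ‖z‖ ^ 2 := by positivity
      linarith

omit [MeasurableSpace E] [BorelSpace E] [SecondCountableTopology E] in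
/-- Pointwise majorant of `t^{-1/2}(∂ᵥK_t(x-y) - ∂ᵥK_t(x))` for `2‖y‖ ≤ ‖x‖`:
`≤ (4π)^{-n/2} ‖v‖ ‖y‖ t^{-(n+1)/2-1} e^{-(‖x‖²/32)/t}`. [folklore] -/
theorem abs_rieszIntegrand_sub_le {t : ℝ} (ht : 0 < t) (v : E) {x y : E} (hxy : 2 * ‖y‖ ≤ ‖x‖) :
    |rieszIntegrand v t (x - y) - rieszIntegrand v t x| ≤
      (4 * π) ^ (-(Module.finrank ℝ E : ℝ) / 2) * ‖v‖ * ‖y‖ *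
        (t ^ (-(((Module.finrank ℝ E : ℝ) + 1) / 2) - 1) * rexp (-(‖x‖ ^ 2 / 32 / t))) := by
  rw [rieszIntegrand, rieszIntegrand, ← mul_sub, abs_mul, abs_of_nonneg (Real.rpow_nonneg ht.le _)]
  refine (mul_le_mul_of_nonneg_left (abs_heatKernelDeriv_sub_le ht v hxy)
    (Real.rpow_nonneg ht.le _)).trans (le_of_eq ?_)
  rw [Real.mul_rpow (by positivity) ht.le]
  have he : rexp (-(1 / (32 * t)) * ‖x‖ ^ 2) = rexp (-(‖x‖ ^ 2 / 32 / t)) := by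
    congr 1
    field_simp
  have hp : t ^ (-(1 / 2 : ℝ)) * (t ^ (-(Module.finrank ℝ E : ℝ) / 2) * t⁻¹) =
      t ^ (-(((Module.finrank ℝ E : ℝ) + 1) / 2) - 1) := by
    rw [← Real.rpow_neg_one, ← Real.rpow_add ht, ← Real.rpow_add ht]
    congr 1
    ring
  rw [he, ← hp]
  ring

/-- **Standard kernel estimate for the truncated Riesz kernels, uniformly in the truncation**:
for `2‖y‖ ≤ ‖x‖`, `x ≠ 0`, `|k_{ε,R}(x - y) - k_{ε,R}(x)| ≤ A_n ‖v‖ ‖y‖ ‖x‖^{-(n+1)}`. [folklore] -/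
theorem abs_rieszKernelTrunc_sub_le {ε : ℝ} (hε : 0 < ε) (R : ℝ) (v : E) {x y : E}
    (hx : x ≠ 0) (hxy : 2 * ‖y‖ ≤ ‖x‖) :
    |rieszKernelTrunc v ε R (x - y) - rieszKernelTrunc v ε R x| ≤
      rieszHormanderConst (Module.finrank ℝ E) * ‖v‖ * ‖y‖ *
        (‖x‖ ^ (Module.finrank ℝ E + 1))⁻¹ := by
  set n : ℕ := Module.finrank ℝ E with hn
  have hα0 : 0 < ((n : ℝ) + 1) / 2 := by positivity
  have hxn : 0 < ‖x‖ := norm_pos_iff.2 hx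
  have hc0 : 0 < ‖x‖ ^ 2 / 32 := by positivity
  -- the majorant and its integral
  set G : ℝ → ℝ := fun t => (4 * π) ^ (-(n : ℝ) / 2) * ‖v‖ * ‖y‖ *
    (t ^ (-(((n : ℝ) + 1) / 2) - 1) * rexp (-(‖x‖ ^ 2 / 32 / t))) with hG
  have hGi : IntegrableOn G (Ioi 0) := (integrableOn_rpow_mul_exp_neg_div hα0 hc0).const_mul _
  have hG0 : ∀ t, 0 < t → 0 ≤ G t := fun t ht => by
    rw [hG]
    exact mul_nonneg (by positivity) (mul_nonneg (Real.rpow_nonneg ht.le _) (Real.exp_nonneg _))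
  have hG_int : ∫ t in Ioi 0, G t = (4 * π) ^ (-(n : ℝ) / 2) * ‖v‖ * ‖y‖ *
      ((‖x‖ ^ 2 / 32) ^ (-(((n : ℝ) + 1) / 2)) * Real.Gamma (((n : ℝ) + 1) / 2)) := by
    rw [hG, integral_const_mul, integral_rpow_mul_exp_neg_div_Ioi hα0 hc0]
  -- `(‖x‖²/32)^{-(n+1)/2} = 32^{(n+1)/2} ‖x‖^{-(n+1)}`
  have hpow : (‖x‖ ^ 2 / 32) ^ (-(((n : ℝ) + 1) / 2)) =
      (32 : ℝ) ^ (((n : ℝ) + 1) / 2) * (‖x‖ ^ (n + 1))⁻¹ := by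
    rw [Real.rpow_neg hc0.le, Real.div_rpow (sq_nonneg _) (by norm_num), inv_div,
      ← Real.rpow_natCast ‖x‖ 2, ← Real.rpow_mul hxn.le,
      show ((2 : ℕ) : ℝ) * (((n : ℝ) + 1) / 2) = ((n + 1 : ℕ) : ℝ) by push_cast; ring,
      Real.rpow_natCast, div_eq_mul_inv]
  -- the two kernels as integrals
  have hI := integrableOn_rieszIntegrand hε R v
  rw [rieszKernelTrunc, rieszKernelTrunc, ← mul_sub, ← integral_sub (hI (x - y)) (hI x), abs_mul,
    abs_neg, abs_of_nonneg (by positivity : 0 ≤ 1 / √π)]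
  have h1 : |∫ t in Icc ε R, (rieszIntegrand v t (x - y) - rieszIntegrand v t x)| ≤
      ∫ t in Icc ε R, G t := by
    rw [← Real.norm_eq_abs]
    refine norm_integral_le_of_norm_le (hGi.mono_set fun t ht => hε.trans_le ht.1) ?_
    refine (ae_restrict_iff' measurableSet_Icc).2 (Eventually.of_forall fun t ht => ?_)
    rw [Real.norm_eq_abs]
    exact abs_rieszIntegrand_sub_le (hε.trans_le ht.1) v hxy
  have h2 : ∫ t in Icc ε R, G t ≤ ∫ t in Ioi 0, G t :=
    setIntegral_mono_set hGi
      ((ae_restrict_iff' measurableSet_Ioi).2 (Eventually.of_forall fun t ht => hG0 t ht))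
      ((show Icc ε R ≤ Ioi 0 from fun t ht => hε.trans_le ht.1).eventuallyLE)
  calc 1 / √π * |∫ t in Icc ε R, (rieszIntegrand v t (x - y) - rieszIntegrand v t x)|
      ≤ 1 / √π * ∫ t in Ioi 0, G t := by
        gcongr
        exact h1.trans h2
    _ = rieszHormanderConst n * ‖v‖ * ‖y‖ * (‖x‖ ^ (n + 1))⁻¹ := by
        rw [hG_int, hpow, rieszHormanderConst]
        ring

end KernelDifference

/-! ### Hörmander's integral condition, uniformly in the truncation -/

section Hormander

variable [FiniteDimensional ℝ E] [MeasurableSpace E] [BorelSpace E]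

/-- Change of variables `x = c u` (`c > 0`) for Lebesgue measure on `E`:
`∫ f = c^n ∫ f(c ·)` (Mathlib `Measure.map_addHaar_smul`). [folklore] -/
theorem lintegral_eq_mul_lintegral_comp_smul (f : E → ℝ≥0∞) {c : ℝ} (hc : 0 < c) :
    ∫⁻ x, f x = ENNReal.ofReal (c ^ Module.finrank ℝ E) * ∫⁻ u, f (c • u) := by
  have hc0 : c ≠ 0 := hc.ne'
  let e : E ≃ᵐ E := (Homeomorph.smul (isUnit_iff_ne_zero.2 hc0).unit).toMeasurableEquiv
  have he : (e : E → E) = fun x => c • x := rfl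
  have h1 : ∫⁻ u, f (c • u) = ENNReal.ofReal ((c ^ Module.finrank ℝ E)⁻¹) * ∫⁻ x, f x := by
    calc ∫⁻ u, f (c • u) = ∫⁻ y, f y ∂(Measure.map (fun x => c • x) volume) := by
          rw [← he, lintegral_map_equiv]
          rfl
      _ = ENNReal.ofReal ((c ^ Module.finrank ℝ E)⁻¹) * ∫⁻ x, f x := by
          rw [Measure.map_addHaar_smul volume hc0, lintegral_smul_measure,
            abs_of_nonneg (by positivity), smul_eq_mul]
  rw [h1, ← mul_assoc, ← ENNReal.ofReal_mul (by positivity), mul_inv_cancel₀ (by positivity),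
    ENNReal.ofReal_one, one_mul]

omit [InnerProductSpace ℝ E] [FiniteDimensional ℝ E] [MeasurableSpace E] [BorelSpace E] in
/-- On `{‖u‖ ≥ 2}`: `‖u‖^{-(n+1)} ≤ (3/2)^{n+1} (1 + ‖u‖)^{-(n+1)}`. [folklore] -/
theorem inv_norm_pow_le_of_two_le (n : ℕ) {u : E} (hu : 2 ≤ ‖u‖) :
    (‖u‖ ^ (n + 1))⁻¹ ≤ (3 / 2 : ℝ) ^ (n + 1) * (1 + ‖u‖) ^ (-((n : ℝ) + 1)) := by
  have hu0 : 0 < ‖u‖ := by linarith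
  have h1 : 1 + ‖u‖ ≤ 3 / 2 * ‖u‖ := by linarith
  have h2 : (1 + ‖u‖) ^ (n + 1) ≤ (3 / 2 : ℝ) ^ (n + 1) * ‖u‖ ^ (n + 1) := by
    rw [← mul_pow]
    exact pow_le_pow_left₀ (by positivity) h1 _
  rw [show -((n : ℝ) + 1) = -((n + 1 : ℕ) : ℝ) by push_cast; ring, Real.rpow_neg (by positivity),
    Real.rpow_natCast, inv_le_iff_one_le_mul₀ (by positivity)]
  calc (1 : ℝ) = ((1 + ‖u‖) ^ (n + 1))⁻¹ * (1 + ‖u‖) ^ (n + 1) :=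
        (inv_mul_cancel₀ (by positivity)).symm
    _ ≤ ((1 + ‖u‖) ^ (n + 1))⁻¹ * ((3 / 2 : ℝ) ^ (n + 1) * ‖u‖ ^ (n + 1)) := by gcongr
    _ = (3 / 2 : ℝ) ^ (n + 1) * ((1 + ‖u‖) ^ (n + 1))⁻¹ * ‖u‖ ^ (n + 1) := by ring

/-- The Hörmander constant `B = A_n (3/2)^{n+1} ∫ (1 + ‖u‖)^{-(n+1)} du` (finite). [folklore] -/
def rieszHormanderBound (E : Type*) [NormedAddCommGroup E] [InnerProductSpace ℝ E]
    [FiniteDimensional ℝ E] [MeasurableSpace E] [BorelSpace E] : ℝ≥0∞ :=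
  ENNReal.ofReal (rieszHormanderConst (Module.finrank ℝ E) * (3 / 2 : ℝ) ^ (Module.finrank ℝ E + 1)) *
    ∫⁻ u : E, ENNReal.ofReal ((1 + ‖u‖) ^ (-((Module.finrank ℝ E : ℝ) + 1)))

/-- `B < ∞` (`∫ (1 + ‖u‖)^{-r} du < ∞` for `r > n`). [folklore] -/
theorem rieszHormanderBound_lt_top : rieszHormanderBound E < ⊤ :=
  ENNReal.mul_lt_top ENNReal.ofReal_lt_top
    (finite_integral_one_add_norm (lt_add_one (Module.finrank ℝ E : ℝ)))

/-- **Hörmander's condition for `k_{ε,R}`, uniformly in `0 < ε ≤ R` and in `‖v‖ ≤ 1`**: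
`∫_{‖x‖ ≥ 2‖y‖} |k_{ε,R}(x - y) - k_{ε,R}(x)| dx ≤ B` for every `y`. [folklore] -/
theorem lintegral_rieszKernelTrunc_sub_le {v : E} (hv : ‖v‖ ≤ 1) {ε : ℝ} (hε : 0 < ε) (R : ℝ)
    (y : E) :
    ∫⁻ x in {x : E | 2 * ‖y‖ ≤ ‖x‖},
        ‖rieszKernelTrunc v ε R (x - y) - rieszKernelTrunc v ε R x‖ₑ ≤ rieszHormanderBound E := by
  set n : ℕ := Module.finrank ℝ E with hn
  rcases eq_or_ne y 0 with rfl | hy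
  · simp
  have hyn : 0 < ‖y‖ := norm_pos_iff.2 hy
  have hS : MeasurableSet {x : E | 2 * ‖y‖ ≤ ‖x‖} :=
    measurableSet_le measurable_const measurable_norm
  have hS' : MeasurableSet {u : E | 2 ≤ ‖u‖} := measurableSet_le measurable_const measurable_norm
  -- Step 1: pointwise standard estimate on the integration domain
  set g : E → ℝ≥0∞ := fun x => ENNReal.ofReal (rieszHormanderConst n * ‖y‖ * (‖x‖ ^ (n + 1))⁻¹)
    with hg
  have h1 : ∫⁻ x in {x : E | 2 * ‖y‖ ≤ ‖x‖},
      ‖rieszKernelTrunc v ε R (x - y) - rieszKernelTrunc v ε R x‖ₑ ≤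
      ∫⁻ x in {x : E | 2 * ‖y‖ ≤ ‖x‖}, g x := by
    refine setLIntegral_mono' hS fun x hx => ?_
    have hx' : 2 * ‖y‖ ≤ ‖x‖ := hx
    have hx0 : x ≠ 0 := by
      intro h0
      rw [h0, norm_zero] at hx'
      linarith
    rw [Real.enorm_eq_ofReal_abs, hg]
    refine ENNReal.ofReal_le_ofReal ((abs_rieszKernelTrunc_sub_le hε R v hx0 hx').trans ?_)
    have h0 : 0 ≤ rieszHormanderConst n * ‖y‖ * (‖x‖ ^ (n + 1))⁻¹ := by
      have := rieszHormanderConst_nonneg n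
      positivity
    calc rieszHormanderConst n * ‖v‖ * ‖y‖ * (‖x‖ ^ (n + 1))⁻¹
        = ‖v‖ * (rieszHormanderConst n * ‖y‖ * (‖x‖ ^ (n + 1))⁻¹) := by ring
      _ ≤ 1 * (rieszHormanderConst n * ‖y‖ * (‖x‖ ^ (n + 1))⁻¹) := by gcongr
      _ = _ := one_mul _
  -- Step 2: scaling `x = ‖y‖ u`
  have h2 : ∫⁻ x in {x : E | 2 * ‖y‖ ≤ ‖x‖}, g x =
      ∫⁻ u in {u : E | 2 ≤ ‖u‖}, ENNReal.ofReal (rieszHormanderConst n * (‖u‖ ^ (n + 1))⁻¹) := by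
    rw [← lintegral_indicator hS, lintegral_eq_mul_lintegral_comp_smul _ hyn,
      ← lintegral_const_mul' _ _ ENNReal.ofReal_ne_top, ← lintegral_indicator hS']
    refine lintegral_congr fun u => ?_
    by_cases hu : 2 ≤ ‖u‖
    · have hu0 : 0 < ‖u‖ := lt_of_lt_of_le (by norm_num) hu
      have hmem : ‖y‖ • u ∈ {x : E | 2 * ‖y‖ ≤ ‖x‖} := by
        show 2 * ‖y‖ ≤ ‖‖y‖ • u‖
        rw [norm_smul, Real.norm_of_nonneg hyn.le, mul_comm]
        exact mul_le_mul_of_nonneg_left hu hyn.le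
      have hu' : u ∈ {u : E | 2 ≤ ‖u‖} := hu
      rw [indicator_of_mem hmem, indicator_of_mem hu', hg]
      dsimp only
      rw [← ENNReal.ofReal_mul (by positivity), norm_smul, Real.norm_of_nonneg hyn.le]
      congr 1
      field_simp
      ring
    · have hmem : ‖y‖ • u ∉ {x : E | 2 * ‖y‖ ≤ ‖x‖} := by
        intro h
        have h' : 2 * ‖y‖ ≤ ‖‖y‖ • u‖ := h
        rw [norm_smul, Real.norm_of_nonneg hyn.le] at h'
        have : 2 ≤ ‖u‖ := le_of_mul_le_mul_left (by linarith) hyn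
        exact hu this
      have hu' : u ∉ {u : E | 2 ≤ ‖u‖} := hu
      rw [indicator_of_notMem hmem, indicator_of_notMem hu', mul_zero]
  -- Step 3: the tail integral
  have h3 : ∫⁻ u in {u : E | 2 ≤ ‖u‖}, ENNReal.ofReal (rieszHormanderConst n * (‖u‖ ^ (n + 1))⁻¹) ≤
      rieszHormanderBound E := by
    rw [rieszHormanderBound, ← lintegral_const_mul' _ _ ENNReal.ofReal_ne_top, ← hn]
    refine (setLIntegral_mono' hS' fun u hu => ?_).trans (setLIntegral_le_lintegral _ _)
    rw [← ENNReal.ofReal_mul (by have := rieszHormanderConst_nonneg n; positivity)]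
    refine ENNReal.ofReal_le_ofReal ?_
    rw [mul_assoc]
    exact mul_le_mul_of_nonneg_left (inv_norm_pow_le_of_two_le n hu) (rieszHormanderConst_nonneg n)
  exact h1.trans (h2.le.trans h3)

end Hormander

/-! ### The truncated operators: convolution form, `L²` bound, multiplier form -/

section Operators

variable [FiniteDimensional ℝ E] [MeasurableSpace E] [BorelSpace E]

open scoped Convolution

/-- The real convolution operator `∫ h(t) k(x - t) dt`, complexified, is the complex convolution
`(↑h ⋆ ↑k)(x)`. [folklore] -/
theorem ofReal_integral_mul_kernel (h k : E → ℝ) (x : E) :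
    ((∫ t, h t * k (x - t) : ℝ) : ℂ) =
      ((fun t => (h t : ℂ)) ⋆[ContinuousLinearMap.mul ℂ ℂ, volume] fun t => (k t : ℂ)) x := by
  rw [convolution_def, ← integral_complex_ofReal]
  congr 1
  funext t
  push_cast
  rfl

/-- **The `L²` bound with constant `1`** for the truncated operators on continuous compactly
supported functions (Plancherel and `|m_{ε,R}| ≤ 1`): for `‖v‖ ≤ 1`,
`‖∫ h(t) k_{ε,R}(· - t) dt‖₂ ≤ ‖h‖₂`. [folklore] -/
theorem eLpNorm_two_conv_rieszKernelTrunc_le {v : E} (hv : ‖v‖ ≤ 1) {ε R : ℝ} (hε : 0 < ε)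
    (hR : ε ≤ R) (h : E → ℝ) (hc : Continuous h) (hcs : HasCompactSupport h) :
    eLpNorm (fun x => ∫ t, h t * rieszKernelTrunc v ε R (x - t)) 2 volume ≤ eLpNorm h 2 volume := by
  set k : E → ℝ := rieszKernelTrunc v ε R with hk
  set hc' : E → ℂ := fun t => (h t : ℂ) with hhc
  set kc : E → ℂ := fun t => (k t : ℂ) with hkc
  have hhi : Integrable hc' := (hc.integrable_of_hasCompactSupport hcs).ofReal
  have hki : Integrable kc := (integrable_rieszKernelTrunc v hε hR).ofReal
  have hh2 : MemLp hc' 2 volume := by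
    have h2 : MemLp h 2 volume := hc.memLp_of_hasCompactSupport hcs
    exact h2.ofReal
  -- the convolution is bounded and integrable, hence in `L²`
  obtain ⟨Ch, hCh⟩ := hcs.exists_bound_of_continuous hc
  obtain hM := abs_rieszKernelTrunc_le hε hR v
  set M : ℝ := 1 / √π * (rieszIntegrandBound E ε * ‖v‖ * (R - ε)) with hMdef
  have hconv_int : Integrable (hc' ⋆[ContinuousLinearMap.mul ℂ ℂ, volume] kc) :=
    hhi.integrable_convolution _ hki
  have hconv_bdd : ∀ x, ‖(hc' ⋆[ContinuousLinearMap.mul ℂ ℂ, volume] kc) x‖ ≤ M * ∫ t, ‖hc' t‖ := by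
    intro x
    rw [convolution_def]
    calc ‖∫ t, (ContinuousLinearMap.mul ℂ ℂ) (hc' t) (kc (x - t))‖
        ≤ ∫ t, M * ‖hc' t‖ := by
          refine norm_integral_le_of_norm_le (hhi.norm.const_mul M) (Eventually.of_forall fun t => ?_)
          rw [ContinuousLinearMap.mul_apply', norm_mul, mul_comm]
          gcongr
          rw [hkc]
          dsimp only
          rw [Complex.norm_real, Real.norm_eq_abs]
          exact hM (x - t)
      _ = M * ∫ t, ‖hc' t‖ := integral_const_mul _ _
  have hconv2 : MemLp (hc' ⋆[ContinuousLinearMap.mul ℂ ℂ, volume] kc) 2 volume := by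
    rw [memLp_two_iff_integrable_sq_norm hconv_int.aestronglyMeasurable]
    refine (hconv_int.norm.const_mul (M * ∫ t, ‖hc' t‖)).mono'
      (hconv_int.aestronglyMeasurable.norm.pow 2) (Eventually.of_forall fun x => ?_)
    rw [Real.norm_eq_abs, abs_pow, abs_norm, sq]
    exact mul_le_mul_of_nonneg_right (hconv_bdd x) (norm_nonneg _)
  -- Plancherel and the symbol bound
  have hsymb : ∀ ξ, ‖𝓕 kc ξ‖ ≤ 1 := fun ξ => by
    rw [hkc, hk, fourier_ofReal_rieszKernelTrunc v hε hR ξ]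
    exact (norm_rieszSymbolTrunc_le hε R v ξ).trans hv
  calc eLpNorm (fun x => ∫ t, h t * k (x - t)) 2 volume
      = eLpNorm (hc' ⋆[ContinuousLinearMap.mul ℂ ℂ, volume] kc) 2 volume := by
        refine eLpNorm_congr_norm_ae (Eventually.of_forall fun x => ?_)
        rw [← ofReal_integral_mul_kernel, Complex.norm_real]
    _ = eLpNorm (𝓕 (hc' ⋆[ContinuousLinearMap.mul ℂ ℂ, volume] kc)) 2 volume :=
        (FunctionSpaces.eLpNorm_fourierIntegral_eq hconv_int hconv2).symm
    _ ≤ eLpNorm (𝓕 hc') 2 volume := by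
        refine eLpNorm_mono fun ξ => ?_
        rw [Real.fourier_mul_convolution_eq hhi hki ξ, norm_mul]
        exact mul_le_of_le_one_right (norm_nonneg _) (hsymb ξ)
    _ = eLpNorm hc' 2 volume := FunctionSpaces.eLpNorm_fourierIntegral_eq hhi hh2
    _ = eLpNorm h 2 volume :=
        eLpNorm_congr_norm_ae (Eventually.of_forall fun x => by rw [hhc]; exact Complex.norm_real _)

/-- **Multiplier form of the truncated operators**: for a Schwartz function `f`,
`𝓕⁻¹(m_{ε,R} 𝓕f) = ∫ f(t) k_{ε,R}(· - t) dt` (convolution theorem and Fourier inversion), and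
the right-hand side is continuous. [folklore] -/
theorem fourierInv_rieszSymbolTrunc_mul_eq (v : E) {ε R : ℝ} (hε : 0 < ε) (hR : ε ≤ R)
    (f : SchwartzMap E ℂ) :
    (𝓕⁻ (fun ξ => rieszSymbolTrunc v ε R ξ * 𝓕 (⇑f) ξ) =
        fun x => ∫ t, f t * (rieszKernelTrunc v ε R (x - t) : ℂ)) ∧
      Continuous (fun x => ∫ t, f t * (rieszKernelTrunc v ε R (x - t) : ℂ)) ∧
      Integrable (fun ξ => rieszSymbolTrunc v ε R ξ * 𝓕 (⇑f) ξ) := by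
  set kc : E → ℂ := fun t => (rieszKernelTrunc v ε R t : ℂ) with hkc
  have hki : Integrable kc := (integrable_rieszKernelTrunc v hε hR).ofReal
  have hconv_eq : (⇑f ⋆[ContinuousLinearMap.mul ℂ ℂ, volume] kc) =
      fun x => ∫ t, f t * (rieszKernelTrunc v ε R (x - t) : ℂ) := by
    funext x
    rw [convolution_def]
    rfl
  have hcont : Continuous (⇑f ⋆[ContinuousLinearMap.mul ℂ ℂ, volume] kc) := by
    refine BddAbove.continuous_convolution_left_of_integrable (ContinuousLinearMap.mul ℂ ℂ) ?_
      f.continuous hki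
    refine ⟨‖f.toBoundedContinuousFunction‖, ?_⟩
    rintro _ ⟨x, rfl⟩
    exact f.toBoundedContinuousFunction.norm_coe_le_norm x
  have hint : Integrable (⇑f ⋆[ContinuousLinearMap.mul ℂ ℂ, volume] kc) :=
    f.integrable.integrable_convolution _ hki
  have hF : 𝓕 (⇑f ⋆[ContinuousLinearMap.mul ℂ ℂ, volume] kc) =
      fun ξ => rieszSymbolTrunc v ε R ξ * 𝓕 (⇑f) ξ := by
    funext ξ
    rw [Real.fourier_mul_convolution_eq f.integrable hki ξ, hkc, fourier_ofReal_rieszKernelTrunc v hε hR ξ,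
      mul_comm]
  have hFint : Integrable (𝓕 (⇑f ⋆[ContinuousLinearMap.mul ℂ ℂ, volume] kc)) := by
    have h1 : Integrable (𝓕 (⇑f)) volume := by
      rw [← SchwartzMap.fourier_coe]
      exact (𝓕 f).integrable
    refine (h1.norm.const_mul ‖v‖).mono' ?_ (Eventually.of_forall fun ξ => ?_)
    · exact (FunctionSpaces.continuous_fourierIntegral hint).aestronglyMeasurable
    · rw [hF]
      dsimp only
      rw [norm_mul]
      exact mul_le_mul_of_nonneg_right (norm_rieszSymbolTrunc_le hε R v ξ) (norm_nonneg _)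
  have hinv := hcont.fourierInv_fourier_eq hint hFint
  rw [hF] at hinv hFint
  rw [← hconv_eq]
  exact ⟨hinv, hcont, hFint⟩

end Operators

/-! ### `Lᵖ` bounds: from the admissible class to Schwartz functions, and the limit -/

section LpBounds

variable [FiniteDimensional ℝ E] [MeasurableSpace E] [BorelSpace E]

/-- **Extension from the admissible class to bounded integrable functions** (cut off on balls,
dominated convergence pointwise, Fatou in `Lᵖ`): if `‖∫ g(t)k(·-t)dt‖_p ≤ C‖g‖_p` for bounded
compactly supported measurable `g` (`k` bounded measurable), the same holds for bounded
integrable measurable `g`. [folklore] -/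
theorem eLpNorm_conv_le_of_bounded_integrable {k : E → ℝ} (hk : Measurable k) {M : ℝ}
    (hM : ∀ x, |k x| ≤ M) {p : ℝ≥0∞} {C : ℝ≥0∞}
    (hC : ∀ g : E → ℝ, Measurable g → (∃ B, ∀ x, |g x| ≤ B) → HasCompactSupport g →
      eLpNorm (fun x => ∫ t, g t * k (x - t)) p volume ≤ C * eLpNorm g p volume)
    {g : E → ℝ} (hg : Measurable g) {B : ℝ} (hB : ∀ x, |g x| ≤ B) (hgi : Integrable g) :
    eLpNorm (fun x => ∫ t, g t * k (x - t)) p volume ≤ C * eLpNorm g p volume := by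
  have hM0 : 0 ≤ M := (abs_nonneg _).trans (hM 0)
  set gn : ℕ → E → ℝ := fun N => (Metric.closedBall (0 : E) N).indicator g with hgn
  have hgn_m : ∀ N, Measurable (gn N) := fun N => hg.indicator Metric.isClosed_closedBall.measurableSet
  have hgn_abs : ∀ N x, |gn N x| ≤ |g x| := fun N x => by
    rw [← Real.norm_eq_abs, ← Real.norm_eq_abs]
    exact norm_indicator_le_norm_self _ _
  have hgn_bdd : ∀ N x, |gn N x| ≤ B := fun N x => (hgn_abs N x).trans (hB x)
  have hgn_supp : ∀ N, HasCompactSupport (gn N) := fun N =>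
    HasCompactSupport.intro (isCompact_closedBall (0 : E) N) fun x hx => indicator_of_notMem hx _
  have hgn_lim : ∀ t, Tendsto (fun N => gn N t) atTop (𝓝 (g t)) := by
    intro t
    refine tendsto_const_nhds.congr' ?_
    filter_upwards [eventually_ge_atTop ⌈‖t‖⌉₊] with N hN
    have ht : t ∈ Metric.closedBall (0 : E) N :=
      mem_closedBall_zero_iff.2 ((Nat.le_ceil _).trans (Nat.cast_le.2 hN))
    simp only [hgn, indicator_of_mem ht]
  have hT_lim : ∀ x, Tendsto (fun N => ∫ t, gn N t * k (x - t)) atTop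
      (𝓝 (∫ t, g t * k (x - t))) := by
    intro x
    refine tendsto_integral_of_dominated_convergence (fun t => M * |g t|)
      (fun N => (SingularIntegrals.integrable_mul_kernel hk hM
        (hgi.indicator Metric.isClosed_closedBall.measurableSet) x).aestronglyMeasurable)
      (hgi.abs.const_mul M) (fun N => Eventually.of_forall fun t => ?_)
      (Eventually.of_forall fun t => ((hgn_lim t).mul tendsto_const_nhds))
    rw [Real.norm_eq_abs, abs_mul, mul_comm]
    exact mul_le_mul (hM _) (hgn_abs N t) (abs_nonneg _) hM0
  have hFatou := Lp.eLpNorm_lim_le_liminf_eLpNorm (μ := volume) (p := p)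
    (f := fun N x => ∫ t, gn N t * k (x - t))
    (fun N => (SingularIntegrals.stronglyMeasurable_integral_mul_kernel hk (hgn_m N)).aestronglyMeasurable)
    (fun x => ∫ t, g t * k (x - t)) (Eventually.of_forall hT_lim)
  refine hFatou.trans (liminf_le_of_frequently_le' (Eventually.of_forall fun N => ?_).frequently)
  calc eLpNorm (fun x => ∫ t, gn N t * k (x - t)) p volume ≤ C * eLpNorm (gn N) p volume :=
        hC (gn N) (hgn_m N) ⟨B, hgn_bdd N⟩ (hgn_supp N)
    _ ≤ C * eLpNorm g p volume := by
        gcongr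
        exact eLpNorm_mono fun t => by rw [Real.norm_eq_abs, Real.norm_eq_abs]; exact hgn_abs N t

/-- **From real admissible inputs to complex Schwartz inputs** (real and imaginary parts, cut-off,
Minkowski): the bound `‖∫ g(t)k(·-t)dt‖_p ≤ C‖g‖_p` on the admissible class gives
`‖∫ f(t)k(·-t)dt‖_p ≤ 2C‖f‖_p` for `f ∈ 𝓢(E, ℂ)`, `1 ≤ p`. [folklore] -/
theorem eLpNorm_conv_schwartz_le {k : E → ℝ} (hk : Measurable k) {M : ℝ} (hM : ∀ x, |k x| ≤ M)
    {p : ℝ≥0∞} (hp : 1 ≤ p) {C : ℝ≥0∞}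
    (hC : ∀ g : E → ℝ, Measurable g → (∃ B, ∀ x, |g x| ≤ B) → HasCompactSupport g →
      eLpNorm (fun x => ∫ t, g t * k (x - t)) p volume ≤ C * eLpNorm g p volume)
    (f : SchwartzMap E ℂ) :
    eLpNorm (fun x => ∫ t, f t * (k (x - t) : ℂ)) p volume ≤ 2 * C * eLpNorm (⇑f) p volume := by
  set gr : E → ℝ := fun t => (f t).re with hgr
  set gi : E → ℝ := fun t => (f t).im with hgi
  have hgr_m : Measurable gr := (Complex.continuous_re.comp f.continuous).measurable
  have hgi_m : Measurable gi := (Complex.continuous_im.comp f.continuous).measurable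
  have hfb : ∀ x, ‖f x‖ ≤ ‖f.toBoundedContinuousFunction‖ := fun x =>
    f.toBoundedContinuousFunction.norm_coe_le_norm x
  have hgr_b : ∀ x, |gr x| ≤ ‖f.toBoundedContinuousFunction‖ := fun x =>
    (Complex.abs_re_le_norm _).trans (hfb x)
  have hgi_b : ∀ x, |gi x| ≤ ‖f.toBoundedContinuousFunction‖ := fun x =>
    (Complex.abs_im_le_norm _).trans (hfb x)
  have hfi : Integrable (⇑f) volume := f.integrable
  have hgr_i : Integrable gr := hfi.re
  have hgi_i : Integrable gi := hfi.im
  -- decomposition into real and imaginary parts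
  have hdecomp : ∀ x, ∫ t, f t * (k (x - t) : ℂ) =
      ((∫ t, gr t * k (x - t) : ℝ) : ℂ) + ((∫ t, gi t * k (x - t) : ℝ) : ℂ) * Complex.I := by
    intro x
    have h1 : (fun t => f t * (k (x - t) : ℂ)) = fun t =>
        ((gr t * k (x - t) : ℝ) : ℂ) + ((gi t * k (x - t) : ℝ) : ℂ) * Complex.I := by
      funext t
      rw [hgr, hgi]
      dsimp only
      conv_lhs => rw [← Complex.re_add_im (f t)]
      push_cast
      ring
    have hA : Integrable (fun t => ((gr t * k (x - t) : ℝ) : ℂ)) :=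
      (SingularIntegrals.integrable_mul_kernel hk hM hgr_i x).ofReal
    have hB : Integrable (fun t => ((gi t * k (x - t) : ℝ) : ℂ) * Complex.I) :=
      (SingularIntegrals.integrable_mul_kernel hk hM hgi_i x).ofReal.mul_const _
    rw [h1, integral_add hA hB, integral_mul_const, integral_complex_ofReal, integral_complex_ofReal]
  have hTr := eLpNorm_conv_le_of_bounded_integrable hk hM hC hgr_m hgr_b hgr_i
  have hTi := eLpNorm_conv_le_of_bounded_integrable hk hM hC hgi_m hgi_b hgi_i
  have hmeas_r : AEStronglyMeasurable (fun x => ((∫ t, gr t * k (x - t) : ℝ) : ℂ)) volume :=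
    (Complex.continuous_ofReal.comp_stronglyMeasurable
      (SingularIntegrals.stronglyMeasurable_integral_mul_kernel hk hgr_m)).aestronglyMeasurable
  have hmeas_i : AEStronglyMeasurable
      (fun x => ((∫ t, gi t * k (x - t) : ℝ) : ℂ) * Complex.I) volume :=
    (Complex.continuous_ofReal.comp_stronglyMeasurable
      (SingularIntegrals.stronglyMeasurable_integral_mul_kernel hk hgi_m)).aestronglyMeasurable.mul_const _
  calc eLpNorm (fun x => ∫ t, f t * (k (x - t) : ℂ)) p volume
      = eLpNorm ((fun x => ((∫ t, gr t * k (x - t) : ℝ) : ℂ)) +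
          fun x => ((∫ t, gi t * k (x - t) : ℝ) : ℂ) * Complex.I) p volume := by
        congr 1
        funext x
        exact hdecomp x
    _ ≤ eLpNorm (fun x => ((∫ t, gr t * k (x - t) : ℝ) : ℂ)) p volume +
          eLpNorm (fun x => ((∫ t, gi t * k (x - t) : ℝ) : ℂ) * Complex.I) p volume :=
        eLpNorm_add_le hmeas_r hmeas_i hp
    _ = eLpNorm (fun x => ∫ t, gr t * k (x - t)) p volume +
          eLpNorm (fun x => ∫ t, gi t * k (x - t)) p volume := by
        congr 1
        · exact eLpNorm_congr_norm_ae (Eventually.of_forall fun x => Complex.norm_real _)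
        · exact eLpNorm_congr_norm_ae (Eventually.of_forall fun x => by
            rw [norm_mul, Complex.norm_I, mul_one, Complex.norm_real])
    _ ≤ C * eLpNorm gr p volume + C * eLpNorm gi p volume := add_le_add hTr hTi
    _ ≤ C * eLpNorm (⇑f) p volume + C * eLpNorm (⇑f) p volume := by
        gcongr
        · exact eLpNorm_mono fun x => by rw [Real.norm_eq_abs]; exact Complex.abs_re_le_norm _
        · exact eLpNorm_mono fun x => by rw [Real.norm_eq_abs]; exact Complex.abs_im_le_norm _
    _ = 2 * C * eLpNorm (⇑f) p volume := by ring

/-- a.e. `ξ ≠ 0` (Lebesgue measure on a nontrivial space has no atoms). [folklore] -/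
theorem ae_ne_zero [Nontrivial E] : ∀ᵐ ξ ∂(volume : Measure E), ξ ≠ 0 := by
  have : ({(0 : E)} : Set E)ᶜ ∈ ae (volume : Measure E) :=
    compl_mem_ae_iff.2 (measure_singleton _)
  filter_upwards [this] with s hs
  simpa using hs

/-- **The `Lᵖ` bound for the directional Riesz transforms on Schwartz functions**, `1 < p < ∞`:
one constant `C = C(E, p)` with `‖𝓕⁻¹(m_v 𝓕f)‖_p ≤ C ‖f‖_p` for all `‖v‖ ≤ 1` and
`f ∈ 𝓢(E, ℂ)`, `m_v(ξ) = -i⟪ξ, v⟫/‖ξ‖` (Calderón–Zygmund for the truncations, uniformly; dominated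
convergence on the Fourier side; Fatou). [cite: Grafakos2014, Cor. 5.2.8; Stein1971, Ch. II §3.2 Thm 2] -/
theorem exists_eLpNorm_fourierInv_rieszSymbolDir_le [Nontrivial E] {p : ℝ≥0∞} (hp1 : 1 < p)
    (hp2 : p < ⊤) :
    ∃ C : ℝ≥0, ∀ v : E, ‖v‖ ≤ 1 → ∀ f : SchwartzMap E ℂ,
      eLpNorm (𝓕⁻ (fun ξ => rieszSymbolDir v ξ * 𝓕 (⇑f) ξ)) p volume ≤ C * eLpNorm (⇑f) p volume := by
  obtain ⟨C, hC⟩ := SingularIntegrals.exists_eLpNorm_le (Module.finrank ℝ E) 1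
    (rieszHormanderBound E).toNNReal hp1 hp2
  refine ⟨2 * C, fun v hv f => ?_⟩
  set ε : ℕ → ℝ := fun m => 1 / ((m : ℝ) + 1) with hεdef
  set R : ℕ → ℝ := fun m => (m : ℝ) + 1 with hRdef
  have hε : ∀ m, 0 < ε m := fun m => by rw [hεdef]; positivity
  have hεR : ∀ m, ε m ≤ R m := fun m => by
    rw [hεdef, hRdef]
    dsimp only
    rw [div_le_iff₀ (by positivity)]
    nlinarith [(Nat.cast_nonneg m : (0 : ℝ) ≤ m), sq_nonneg (m : ℝ)]
  set T : ℕ → E → ℂ := fun m x => ∫ t, f t * (rieszKernelTrunc v (ε m) (R m) (x - t) : ℂ) with hT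
  -- (a) the uniform `Lᵖ` bound for the truncations
  have ha : ∀ m, eLpNorm (T m) p volume ≤ ((2 * C : ℝ≥0) : ℝ≥0∞) * eLpNorm (⇑f) p volume := by
    intro m
    have hk := measurable_rieszKernelTrunc v (ε m) (R m)
    have hkM := abs_rieszKernelTrunc_le (hε m) (hεR m) v
    have hreal := hC (volume : Measure E) rfl hk ⟨_, hkM⟩
      (fun h hc hcs => by
        rw [ENNReal.coe_one, one_mul]
        exact eLpNorm_two_conv_rieszKernelTrunc_le hv (hε m) (hεR m) h hc hcs)
      (fun y => by
        rw [ENNReal.coe_toNNReal rieszHormanderBound_lt_top.ne]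
        exact lintegral_rieszKernelTrunc_sub_le hv (hε m) (R m) y)
    have h := eLpNorm_conv_schwartz_le hk hkM hp1.le (C := (C : ℝ≥0∞)) hreal f
    rw [hT]
    push_cast
    exact h
  -- (b) pointwise convergence to the Riesz transform
  have hfF : Integrable (𝓕 (⇑f)) volume := by
    rw [← SchwartzMap.fourier_coe]
    exact (𝓕 f).integrable
  have hchar : ∀ x : E, Continuous fun ξ : E => ((𝐞 ⟪ξ, x⟫ : Circle) : ℂ) := fun x =>
    continuous_subtype_val.comp (Real.continuous_fourierChar.comp (continuous_id.inner continuous_const))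
  have hb : ∀ x, Tendsto (fun m => T m x) atTop
      (𝓝 (𝓕⁻ (fun ξ => rieszSymbolDir v ξ * 𝓕 (⇑f) ξ) x)) := by
    intro x
    have hrepr : ∀ m, T m x = ∫ ξ, ((𝐞 ⟪ξ, x⟫ : Circle) : ℂ) *
        (rieszSymbolTrunc v (ε m) (R m) ξ * 𝓕 (⇑f) ξ) := fun m => by
      have h1 := congrFun (fourierInv_rieszSymbolTrunc_mul_eq v (hε m) (hεR m) f).1 x
      rw [hT]
      dsimp only
      rw [← h1, Real.fourierInv_eq]
      simp only [Circle.smul_def, smul_eq_mul]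
    have hlim_eq : 𝓕⁻ (fun ξ => rieszSymbolDir v ξ * 𝓕 (⇑f) ξ) x =
        ∫ ξ, ((𝐞 ⟪ξ, x⟫ : Circle) : ℂ) * (rieszSymbolDir v ξ * 𝓕 (⇑f) ξ) := by
      rw [Real.fourierInv_eq]
      simp only [Circle.smul_def, smul_eq_mul]
    simp_rw [hrepr, hlim_eq]
    refine tendsto_integral_of_dominated_convergence (fun ξ => ‖𝓕 (⇑f) ξ‖) (fun m => ?_)
      hfF.norm (fun m => Eventually.of_forall fun ξ => ?_) ?_
    · exact ((hchar x).aestronglyMeasurable).mul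
        (fourierInv_rieszSymbolTrunc_mul_eq v (hε m) (hεR m) f).2.2.aestronglyMeasurable
    · rw [norm_mul, Circle.norm_coe, one_mul, norm_mul]
      exact mul_le_of_le_one_left (norm_nonneg _) ((norm_rieszSymbolTrunc_le (hε m) (R m) v ξ).trans hv)
    · filter_upwards [ae_ne_zero (E := E)] with ξ hξ
      exact (((tendsto_rieszSymbolTrunc v hξ).mul_const (𝓕 (⇑f) ξ)).const_mul _)
  -- (c) Fatou
  have hFatou := Lp.eLpNorm_lim_le_liminf_eLpNorm (μ := volume) (p := p) (f := T)
    (fun m => (fourierInv_rieszSymbolTrunc_mul_eq v (hε m) (hεR m) f).2.1.aestronglyMeasurable)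
    _ (Eventually.of_forall hb)
  exact hFatou.trans (liminf_le_of_frequently_le' (Eventually.of_forall fun m => ha m).frequently)

end LpBounds

/-! ### The theorem: the Riesz transforms are `Lᵖ` multipliers, `1 < p < ∞` -/

section Final

variable {d : ℕ}

/-- `rⱼ = m_{eⱼ}`: the Riesz symbol is the directional symbol of the `j`-th unit vector. [folklore] -/
theorem rieszSymbol_eq_rieszSymbolDir (j : Fin d) (ξ : EuclideanSpace ℝ (Fin d)) :
    rieszSymbol j ξ = rieszSymbolDir (EuclideanSpace.single j (1 : ℝ)) ξ := by
  rw [rieszSymbol, rieszSymbolDir, EuclideanSpace.inner_single_right]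
  simp only [one_mul, conj_trivial]
  ring

/-- The Riesz symbol is measurable. [folklore] -/
theorem measurable_rieszSymbol (j : Fin d) :
    Measurable (fun ξ : EuclideanSpace ℝ (Fin d) => rieszSymbol j ξ) := by
  unfold rieszSymbol
  have h1 : Measurable fun ξ : EuclideanSpace ℝ (Fin d) => ξ j :=
    (PiLp.continuous_apply 2 (fun _ : Fin d => ℝ) j).measurable
  exact measurable_const.mul (Complex.measurable_ofReal.comp (h1.div measurable_norm))

/-- **Discharge of `rieszTransform_isLpMultiplier`: the Riesz transforms `Rⱼ`, with symbols
`-iξⱼ/|ξ|`, are `Lᵖ(ℝᵈ)` Fourier multipliers for `1 < p < ∞`** (acting componentwise on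
`ℂᵏ`-valued Schwartz functions). Printed statement: [Grafakos2014, Cor. 5.2.8] ("The Riesz
transforms `Rⱼ` ... are bounded on `Lᵖ(ℝⁿ)` for `1 < p < ∞`") with [Grafakos2014, Prop. 5.1.14]
(`Rⱼ(f) = (-iξⱼ/|ξ| f̂)^∨` for `f ∈ 𝒮`). Proof as formalised: not the printed method of
rotations but the Calderón–Zygmund theorem for convolution kernels with an `L²` bound and
Hörmander's condition [Grafakos2014, Thm. 5.3.3; Stein1971, Ch. II §3.2 Thm 2] (proved in the tree,
`Literature.Analysis.SingularIntegrals.exists_eLpNorm_le`), applied uniformly to the smooth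
integrable truncations `k_{ε,R} = -π^{-1/2}∫_ε^R t^{-1/2} ∂ⱼK_t dt` of the Riesz kernel
subordinated to the heat kernel `K_t` (`|ξ|^{-1} = π^{-1/2}∫_0^∞ t^{-1/2}e^{-t|ξ|²}dt`,
[Stein1971, Ch. III §3.4 proof of the Lemma]): their symbols `-2√π iξⱼ∫_ε^R t^{-1/2}e^{-4π²t|ξ|²}dt`
are bounded by `1` and converge to `-iξⱼ/|ξ|`, their Hörmander constants are uniform (standard
estimate `|k(x-y)-k(x)| ≤ A|y||x|^{-d-1}`, `2|y| ≤ |x|`); the `Lᵖ` bound passes from the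
admissible class to Schwartz functions by cut-off and Fatou, to the limit `ε → 0`, `R → ∞` by
dominated convergence on the Fourier side and Fatou, and to `ℂᵏ`-valued functions componentwise.
[cite: Grafakos2014, Cor. 5.2.8 and Prop. 5.1.14] -/
theorem rieszTransform_isLpMultiplier_holds : rieszTransform_isLpMultiplier := by
  intro d k j p hp1 hp2
  have hd : 0 < d := Fin.pos j
  haveI : Nontrivial (EuclideanSpace ℝ (Fin d)) :=
    Module.nontrivial_of_finrank_pos (R := ℝ) (by rw [finrank_euclideanSpace_fin]; exact hd)
  obtain ⟨C, hC⟩ := exists_eLpNorm_fourierInv_rieszSymbolDir_le (E := EuclideanSpace ℝ (Fin d)) hp1 hp2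
  set v : EuclideanSpace ℝ (Fin d) := EuclideanSpace.single j (1 : ℝ) with hv
  have hv1 : ‖v‖ ≤ 1 := by
    rw [hv, EuclideanSpace.single, PiLp.norm_single, norm_one]
  -- the symbol as a scalar action
  have hsymb : ∀ (ξ : EuclideanSpace ℝ (Fin d)) (w : Fin k → ℂ),
      (rieszSymbol j ξ • (1 : Matrix (Fin k) (Fin k) ℂ)).mulVec w = rieszSymbol j ξ • w := by
    intro ξ w
    rw [Matrix.smul_mulVec, Matrix.one_mulVec]
  have hguard : ∀ f : SchwartzMap (EuclideanSpace ℝ (Fin d)) (Fin k → ℂ),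
      Integrable (fun ξ => (rieszSymbol j ξ • (1 : Matrix (Fin k) (Fin k) ℂ)).mulVec (𝓕 (⇑f) ξ)) := by
    intro f
    have hfF : Integrable (𝓕 (⇑f)) volume := by
      rw [← SchwartzMap.fourier_coe]
      exact (𝓕 f).integrable
    simp_rw [hsymb]
    exact hfF.bdd_smul 1 (measurable_rieszSymbol j).aestronglyMeasurable
      (Eventually.of_forall fun ξ => norm_rieszSymbol_le j ξ)
  refine ⟨(k : ℝ≥0) * C, hguard, fun f => ?_⟩
  have hp : 1 ≤ p := hp1.le
  have hfi : Integrable (⇑f) volume := f.integrable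
  -- the components of the multiplier operator are scalar Riesz transforms of the components
  set fi : Fin k → SchwartzMap (EuclideanSpace ℝ (Fin d)) ℂ := fun i =>
    SchwartzMap.postcompCLM (𝕜 := ℂ) (ContinuousLinearMap.proj (R := ℂ) (φ := fun _ : Fin k => ℂ) i) f
    with hfi_def
  have hfi_apply : ∀ i x, fi i x = f x i := fun i x => rfl
  have hG : Integrable (fun ξ => rieszSymbol j ξ • 𝓕 (⇑f) ξ) volume := by
    have h := hguard f
    simp_rw [hsymb] at h
    exact h
  have hcomp : ∀ i, (fun x => multiplierOp (fun ξ => rieszSymbol j ξ • (1 : Matrix (Fin k) (Fin k) ℂ)) ⇑f x i) =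
      𝓕⁻ (fun ξ => rieszSymbolDir v ξ * 𝓕 (⇑(fi i)) ξ) := by
    intro i
    have hfun : (fun ξ => (rieszSymbol j ξ • 𝓕 (⇑f) ξ) i) =
        fun ξ => rieszSymbolDir v ξ * 𝓕 (⇑(fi i)) ξ := by
      funext ξ
      rw [Pi.smul_apply, smul_eq_mul, fourier_apply_apply hfi ξ i, rieszSymbol_eq_rieszSymbolDir]
      rfl
    funext x
    rw [multiplierOp_apply]
    simp_rw [hsymb]
    rw [fourierInv_apply_apply hG x i, hfun]
  -- measurability of the components
  have hmeas : ∀ i, AEStronglyMeasurable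
      (fun x => multiplierOp (fun ξ => rieszSymbol j ξ • (1 : Matrix (Fin k) (Fin k) ℂ)) ⇑f x i) volume := by
    intro i
    rw [hcomp i]
    refine (continuous_fourierInv_of_integrable ?_).aestronglyMeasurable
    have h1 : Integrable (𝓕 (⇑(fi i))) volume := by
      rw [← SchwartzMap.fourier_coe]
      exact (𝓕 (fi i)).integrable
    have hms : AEStronglyMeasurable (fun ξ : EuclideanSpace ℝ (Fin d) => rieszSymbolDir v ξ) volume := by
      have : (fun ξ : EuclideanSpace ℝ (Fin d) => rieszSymbolDir v ξ) = fun ξ => rieszSymbol j ξ :=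
        funext fun ξ => (rieszSymbol_eq_rieszSymbolDir j ξ).symm
      rw [this]
      exact (measurable_rieszSymbol j).aestronglyMeasurable
    exact h1.bdd_mul hms (Eventually.of_forall fun ξ => (norm_rieszSymbolDir_le v ξ).trans hv1)
  -- assemble
  calc eLpNorm (multiplierOp (fun ξ => rieszSymbol j ξ • (1 : Matrix (Fin k) (Fin k) ℂ)) ⇑f) p volume
      ≤ ∑ i, eLpNorm (fun x => multiplierOp (fun ξ => rieszSymbol j ξ • (1 : Matrix (Fin k) (Fin k) ℂ)) ⇑f x i)
          p volume := eLpNorm_pi_le_sum hmeas hp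
    _ ≤ ∑ i : Fin k, (C : ℝ≥0∞) * eLpNorm (⇑f) p volume := by
        refine Finset.sum_le_sum fun i _ => ?_
        rw [hcomp i]
        refine (hC v hv1 (fi i)).trans ?_
        gcongr
        exact eLpNorm_mono fun x => by rw [hfi_apply]; exact norm_le_pi_norm (f x) i
    _ = (((k : ℝ≥0) * C : ℝ≥0) : ℝ≥0∞) * eLpNorm (⇑f) p volume := by
        rw [Finset.sum_const, Finset.card_univ, Fintype.card_fin, nsmul_eq_mul]
        push_cast
        ring

end Final

end Literature.Analysis.Fourier
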